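import Literature.NumberTheory.Sieve.MoebiusShiftedPrimesSmoothedMeanValues
import Literature.NumberTheory.LFunctions.DirichletPolynomialLargeValuesSharp
import HarnessLib

/-!
# Möbius on shifted primes — Proposition 5.1 of Lichtman 2020 at the PRINTED exponent, proved

Topic `Literature/NumberTheory/Sieve`, third file (after `MoebiusShiftedPrimesSmoothedRamare.lean` and
`MoebiusShiftedPrimesSmoothedMeanValues.lean`) of the repair of the printed proof of Proposition 5.1 of
J. D. Lichtman, *Averages of the Möbius function on shifted primes*, Q. J. Math. 73 (2022) 729–757,
arXiv:2009.08969v2 [Lichtman2020], at the printed first exponent `P₁ = (log X)^{33A}` of the typical set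
`S = S(X,A,δ)` — the exponent that the named facts `Lichtman2020_majorArcEstimate` (Proposition 3.2) and
`Lichtman2020_liouvilleMeanSquare` (Proposition 3.4) of the tree carry, and at which the printed proof has
a gap (`MoebiusShiftedPrimesTypical.lean`; the tree's `dirichletMeanValue_strong` needs `P₁ = (log X)^{cA}`,
`c ≥ 100`).  Everything in this file is PROVED; there are no named facts.  (A different, weaker repair
— Proposition 5.1 with the honest saving `(log X)^{-3A}` and the major arcs by sub-windows, giving
`HX/(dW^{1/5})` in place of Proposition 3.2 — is the tree's `MoebiusShiftedPrimesDirichletMeanValue33.lean`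
/ `…MajorArcs33.lean`; the present route keeps the printed savings `(log X)^{-11A}`, `W^{-10}`, `W^{-1}`
of Propositions 5.1, 3.4, 3.2.)

* `dirichletMeanValue33_strong (h45 : Lichtman2020_primeCharacterSum)` — **Proposition 5.1 at the
  printed exponent**: for `A > 5`, `δ > 0`, `H` in the regime, eventually in `X`, for `q ≤ (log X)^A`,
  `χ (mod q)`, `Y ∈ [X/(log X)^{6A}, 2X]`, `T ∈ [0, 2X]`:
  `∫_{(log X)^{22A}}^{T} |∑_{Y ≤ n ≤ 2Y, n ∈ S} λχ(n) n^{-1-it}|² dt ≤ C (Q₁T/Y + 1)(log X)^{-11A}`.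
  The only printed input is Lemma 4.5 (Vinogradov–Korobov for prime character sums, the named fact
  `Lichtman2020_primeCharacterSum`, which follows from Khale's zero-free region,
  `Lichtman2020_primeCharacterSum_of_khale`).

## The repaired argument (§5.1 with three changes)

1. The first Ramaré decomposition (along `[P₁, Q₁]`) is SMOOTHED and separated EXACTLY
   (`decomposition'`, `mainPlus_eq_integral`): the block fineness is the constant `V₁ = 2`, the threshold
   exponent `α = 1/5`, and `E₁ ≪ (A log log X)² P₁^{-2/5} (Q₁T/Y + 1) = o((log X)^{-11A}(Q₁T/Y+1))`
   (`goodPart_le`; smoothing frequency `λ = (log X)^{17A}`, transition width `δ₀ = (log X)^{-11A}/16`).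
2. Because the main term is an average over shifts `|u| ≤ 2λ`, a unit interval is treated as good only
   if all unit intervals within `R = ⌈2λ⌉ + 1` are good; the bad set is enlarged accordingly
   (`shifts_good`, `card_enlarged_le`, factor `2R + 1`).
3. The bad points are counted with the SHARP form of Matomäki–Radziwiłł's Lemma 8 (exponent `4`,
   `MatomakiRadziwill2016_lemma8_sharp`, proved in the tree from Lemma 7): with `V₁ = 2`,
   `v₀ ≥ 65A log log X`, the count is `≪ T^{2/5 + 16/(65A) + o(1)}`, and `(2R+1)#B√T ≤ Y/Q₂` needs
   `9/10 + 16/(65A) < 1` (`cardB_bound33`).  The tree's explicit Lemma 8 (exponent `16`) would not do at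
   `A` near `5`.
The second decomposition (`[P₂, Q₂]`, `V₂ = (log X)^{11A}`), `E₂` (Lemma 4.5 pointwise on
`|t| ≥ T₀ = (log X)^{22A}`, Halász–Montgomery at the maximisers) and all other parameters are those of the
tree's `prop51_fixed`/`dirichletMeanValue_strong`, whose lemmas (`ramare_second`, `E2_block`, `UQ_bound`,
`E2_factor_numerics`, `err_numerics`) are used verbatim (`prop51_fixed33`).

## Content

`Lemma8SharpWith`, `exists_lemma8SharpWith`, `card_badClass_le_sharp`, `card_bad_le_sharp`; `GoodAt`,
`shifts_good`, `card_enlarged_le`; `prop51_fixed33` (fixed parameters); numerics (`ratio_le`,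
`G1_numerics` … `G4_numerics`, `final_numerics33`, `eta1_bound`, `eta'_bound`, `Phi_bound`,
`Lambda0_K_bound`, `G4_inputs`, `prod_le_X`, `exp_four_le`); `cardB_bound33`; `dirichletMeanValue33_strong`.

## References

* J. D. Lichtman, arXiv:2009.08969v2, Proposition 5.1 and §5.1, (5.7)–(5.10), pp. 14–15 [Lichtman2020].
* K. Matomäki, M. Radziwiłł, Ann. of Math. (2) 183 (2016), Lemmas 7, 8, 9, 12 [MatomakiRadziwillAnnals2016].
-/

noncomputable section

open Finset Real Complex MeasureTheory Filter
open scoped Topology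

namespace Literature.NumberTheory.Sieve.Lichtman2020.Smoothed

open Literature.NumberTheory.LFunctions Literature.NumberTheory.LFunctions.FejerSmoothing
open MatomakiRadziwillLemma12

/-! ### Counting the bad intervals with the sharp form of Matomäki–Radziwiłł's Lemma 8 -/

/-- The hypothesis-shape of the sharp Lemma 8 (`MatomakiRadziwill2016_lemma8_sharp`, exponent `4`)
with constant `C₈`. [cite: MatomakiRadziwillAnnals2016, Lemma 8] -/
def Lemma8SharpWith (C₈ : ℝ) : Prop :=
  ∀ (P T V : ℝ) (a : ℕ → ℂ) (𝒯 : Finset ℝ), 2 ≤ P → P ^ 2 ≤ T →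
    Real.exp (Real.exp 4) ≤ T → 1 ≤ V → (∀ p, ‖a p‖ ≤ 1) → (∀ t ∈ 𝒯, |t| ≤ T) →
    (∀ t ∈ 𝒯, ∀ t' ∈ 𝒯, t ≠ t' → 1 ≤ |t - t'|) →
    (∀ t ∈ 𝒯, V⁻¹ ≤ ‖∑ p ∈ (Icc ⌈P⌉₊ ⌊2 * P⌋₊).filter Nat.Prime,
        a p * (p : ℂ) ^ (-(1 + (t : ℂ) * I))‖) →
    (#𝒯 : ℝ) ≤ C₈ * V ^ 2 * T ^ (2 * Real.log V / Real.log P)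
      * Real.exp (4 * (Real.log T / Real.log P) * Real.log (Real.log T))

/-- The sharp Lemma 8 holds with some constant (Lemma 7 being proved in the tree). [cite: MatomakiRadziwillAnnals2016, Lemma 8] -/
theorem exists_lemma8SharpWith : ∃ C₈, 0 ≤ C₈ ∧ Lemma8SharpWith C₈ := by
  obtain ⟨C, hC⟩ := DirichletLargeValues.MatomakiRadziwill2016_lemma8_sharp MatomakiRadziwill2016_lemma7_holds
  refine ⟨max C 0, le_max_right _ _, ?_⟩
  intro P T V a 𝒯 hP hPT hT hV ha h𝒯T hws hlarge
  refine (hC P T V a 𝒯 hP hPT hT hV ha h𝒯T hws hlarge).trans ?_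
  have h0 : 0 ≤ V ^ 2 * T ^ (2 * Real.log V / Real.log P)
      * Real.exp (4 * (Real.log T / Real.log P) * Real.log (Real.log T)) := by
    have : 0 ≤ T := by
      have := Real.exp_pos (Real.exp 4); linarith
    have : 0 ≤ T ^ (2 * Real.log V / Real.log P) := Real.rpow_nonneg this _
    positivity
  calc C * V ^ 2 * T ^ (2 * Real.log V / Real.log P) * Real.exp (4 * (Real.log T / Real.log P) * Real.log (Real.log T))
      = C * (V ^ 2 * T ^ (2 * Real.log V / Real.log P) * Real.exp (4 * (Real.log T / Real.log P) * Real.log (Real.log T))) := by ring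
    _ ≤ max C 0 * (V ^ 2 * T ^ (2 * Real.log V / Real.log P) * Real.exp (4 * (Real.log T / Real.log P) * Real.log (Real.log T))) :=
        mul_le_mul_of_nonneg_right (le_max_left _ _) h0
    _ = _ := by ring

/-- **One parity class of one block, sharp form**: the unit intervals `n` (of parity `r`) carrying a
point where `|Q_{u,1}(1+it)| > e^{-αu/V}` number at most `C₈ e^{2αu/V} T'^{2α} exp(4 (V log T'/u) log log T')`
(the sharp Lemma 8 at well-spaced witnesses, `P = e^{u/V}`, `V₈ = e^{αu/V}`; needs `2 ≤ e^{u/V}`,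
`e^{2u/V} ≤ T'`, `T' ≥ e^{e⁴}`). [cite: Lichtman2020, §5.1, (5.10)] -/
theorem card_badClass_le_sharp {C₈ : ℝ} (h8 : Lemma8SharpWith C₈) {c : ℕ → ℂ} (hc : ∀ p, ‖c p‖ ≤ 1)
    {P₁ Q₁ V α : ℝ} (hV : 2 ≤ V) (hα : 0 < α) {u : ℕ} (Nmax : ℕ) (hu2 : 2 ≤ Real.exp (u / V))
    (huT : Real.exp (u / V) ^ 2 ≤ (Nmax : ℝ) + 1) (hTe : Real.exp (Real.exp 4) ≤ (Nmax : ℝ) + 1)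
    (B : Finset ℕ) (hB : ∀ n ∈ B, n ≤ Nmax ∧ ∃ t ∈ Set.Icc (n : ℝ) (n + 1),
      Real.exp (-(α * u / V)) < ‖blockPrimePoly c P₁ Q₁ V u t‖) (r : ℕ) :
    (#(B.filter (fun k => k % 2 = r)) : ℝ) ≤
      C₈ * Real.exp (2 * α * u / V) * ((Nmax : ℝ) + 1) ^ (2 * α) *
        Real.exp (4 * (V * Real.log ((Nmax : ℝ) + 1) / u) * Real.log (Real.log ((Nmax : ℝ) + 1))) := by
  classical
  set T' : ℝ := (Nmax : ℝ) + 1 with hT'def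
  have hV0 : 0 < V := by linarith
  -- witnesses
  have hex : ∀ n, ∃ t : ℝ, n ∈ B → (t ∈ Set.Icc (n : ℝ) (n + 1) ∧
      Real.exp (-(α * u / V)) < ‖blockPrimePoly c P₁ Q₁ V u t‖) := by
    intro n
    by_cases hn : n ∈ B
    · obtain ⟨-, t, ht, hlt⟩ := hB n hn
      exact ⟨t, fun _ => ⟨ht, hlt⟩⟩
    · exact ⟨n, fun h => absurd h hn⟩
  choose ssel hssel using hex
  have ht : ∀ n ∈ B, (n : ℝ) ≤ ssel n ∧ ssel n ≤ n + 1 := fun n hn => (hssel n hn).1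
  obtain ⟨hws, hcardW, -⟩ := parity_image_facts ht r (fun _ => (0 : ℝ))
  rw [← hcardW]
  set 𝒲 := (B.filter (fun k => k % 2 = r)).image ssel with h𝒲
  -- Lemma 8 data
  set Pd : ℝ := Real.exp (u / V) with hPd
  set V₈ : ℝ := Real.exp (α * u / V) with hV₈
  have hu0 : (0 : ℝ) < u := by
    by_contra h
    push Not at h
    have : (u : ℝ) = 0 := le_antisymm h (Nat.cast_nonneg u)
    rw [hPd, this, zero_div, Real.exp_zero] at hu2
    linarith
  have hV₈1 : 1 ≤ V₈ := Real.one_le_exp (by positivity)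
  have hlogPd : Real.log Pd = u / V := Real.log_exp _
  have hlogV₈ : Real.log V₈ = α * u / V := Real.log_exp _
  have ha : ∀ p, ‖(if p ∈ primeBlock P₁ Q₁ V u then c p else 0)‖ ≤ 1 := fun p => by
    split_ifs
    · exact hc p
    · simp
  have h𝒲T : ∀ t ∈ 𝒲, |t| ≤ T' := by
    intro t ht'
    rw [h𝒲, Finset.mem_image] at ht'
    obtain ⟨n, hn, rfl⟩ := ht'
    rw [Finset.mem_filter] at hn
    obtain ⟨h1, h2⟩ := ht n hn.1
    have hn0 : (0 : ℝ) ≤ n := Nat.cast_nonneg n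
    have hnN : (n : ℝ) ≤ Nmax := by exact_mod_cast (hB n hn.1).1
    rw [abs_of_nonneg (by linarith)]
    simp only [hT'def]; linarith
  have hlarge : ∀ t ∈ 𝒲, V₈⁻¹ ≤ ‖∑ p ∈ (Icc ⌈Pd⌉₊ ⌊2 * Pd⌋₊).filter Nat.Prime,
      (if p ∈ primeBlock P₁ Q₁ V u then c p else 0) * (p : ℂ) ^ (-(1 + (t : ℂ) * I))‖ := by
    intro t ht'
    rw [h𝒲, Finset.mem_image] at ht'
    obtain ⟨n, hn, rfl⟩ := ht'
    rw [Finset.mem_filter] at hn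
    have hlt := (hssel n hn.1).2
    rw [hPd, ← blockPrimePoly_eq_dyadic c hV u]
    rw [hV₈, ← Real.exp_neg]
    exact hlt.le
  have key := h8 Pd T' V₈ _ 𝒲 hu2 huT hTe hV₈1 ha h𝒲T hws hlarge
  refine key.trans (le_of_eq ?_)
  rw [hlogV₈, hlogPd]
  have hV₈2 : V₈ ^ 2 = Real.exp (2 * α * u / V) := by
    rw [hV₈, ← Real.exp_nat_mul]; congr 1; push_cast; ring
  have hexp : 2 * (α * u / V) / (u / V) = 2 * α := by field_simp
  have hrat : Real.log T' / (u / V) = V * Real.log T' / u := by field_simp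
  rw [hV₈2, hexp, hrat]

/-- **The count of the bad intervals, sharp form** (as (5.10), p. 15, with the sharp Lemma 8): a set
`B` of unit intervals `n ≤ N_max`, each carrying some `t ∈ [n, n+1]` and `u ∈ ℐ₁ = [v₀, ⌊V log Q₁⌋]`
with `|Q_{u,1}(1+it)| > e^{-αu/V}`, has
`#B ≤ #ℐ₁ · 2C₈ · Q₁^{2α} T'^{2α} exp(4 (V log T'/v₀) log log T')` (`T' = N_max + 1 ≥ e^{e⁴}`,
`2 ≤ e^{u/V}`, `e^{2u/V} ≤ T'` on `ℐ₁`, `v₀ ≥ 1`). [cite: Lichtman2020, §5.1, (5.10)] -/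
theorem card_bad_le_sharp {C₈ : ℝ} (hC₈ : 0 ≤ C₈) (h8 : Lemma8SharpWith C₈) {c : ℕ → ℂ}
    (hc : ∀ p, ‖c p‖ ≤ 1) {P₁ Q₁ V α : ℝ} (hV : 2 ≤ V) (hα : 0 < α)
    (hQ₁ : 1 ≤ Q₁) {v₀ : ℕ} (hv₀ : 1 ≤ v₀) (Nmax : ℕ) (hTe : Real.exp (Real.exp 4) ≤ (Nmax : ℝ) + 1)
    (hblocks : ∀ u ∈ Icc v₀ ⌊V * Real.log Q₁⌋₊, 2 ≤ Real.exp (u / V) ∧ Real.exp (u / V) ^ 2 ≤ (Nmax : ℝ) + 1)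
    (B : Finset ℕ) (hB : ∀ n ∈ B, n ≤ Nmax ∧ ∃ t ∈ Set.Icc (n : ℝ) (n + 1),
      ∃ u ∈ Icc v₀ ⌊V * Real.log Q₁⌋₊, Real.exp (-(α * u / V)) < ‖blockPrimePoly c P₁ Q₁ V u t‖) :
    (#B : ℝ) ≤ #(Icc v₀ ⌊V * Real.log Q₁⌋₊) * (2 * C₈ * Q₁ ^ (2 * α) * ((Nmax : ℝ) + 1) ^ (2 * α) *
        Real.exp (4 * (V * Real.log ((Nmax : ℝ) + 1) / v₀) * Real.log (Real.log ((Nmax : ℝ) + 1)))) := by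
  classical
  set T' : ℝ := (Nmax : ℝ) + 1 with hT'def
  set ℐ := Icc v₀ ⌊V * Real.log Q₁⌋₊ with hℐ
  have hV0 : 0 < V := by linarith
  -- `B ⊆ ⋃_u Bad_u`
  set Bad : ℕ → Finset ℕ := fun u => B.filter (fun n => ∃ t ∈ Set.Icc (n : ℝ) (n + 1),
    Real.exp (-(α * u / V)) < ‖blockPrimePoly c P₁ Q₁ V u t‖) with hBad
  have hsub : B ⊆ ℐ.biUnion Bad := by
    intro n hn
    obtain ⟨-, t, ht, u, hu, hlt⟩ := hB n hn
    rw [Finset.mem_biUnion]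
    exact ⟨u, hu, Finset.mem_filter.mpr ⟨hn, t, ht, hlt⟩⟩
  have h1 : (#B : ℝ) ≤ ∑ u ∈ ℐ, (#(Bad u) : ℝ) := by
    have := (Finset.card_le_card hsub).trans Finset.card_biUnion_le
    exact_mod_cast this
  refine h1.trans ?_
  rw [← nsmul_eq_mul, ← Finset.sum_const]
  refine Finset.sum_le_sum fun u hu => ?_
  obtain ⟨hu2, huT⟩ := hblocks u hu
  have hBu : ∀ n ∈ Bad u, n ≤ Nmax ∧ ∃ t ∈ Set.Icc (n : ℝ) (n + 1),
      Real.exp (-(α * u / V)) < ‖blockPrimePoly c P₁ Q₁ V u t‖ := by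
    intro n hn
    rw [hBad, Finset.mem_filter] at hn
    exact ⟨(hB n hn.1).1, hn.2⟩
  have hcl := fun r => card_badClass_le_sharp h8 hc hV hα Nmax hu2 huT hTe (Bad u) hBu r
  have hsplit : (#(Bad u) : ℝ) = #((Bad u).filter (fun k => k % 2 = 0)) + #((Bad u).filter (fun k => k % 2 = 1)) := by
    have := Finset.card_filter_add_card_filter_not (s := Bad u) (fun k => k % 2 = 0)
    have e : (Bad u).filter (fun k => ¬ k % 2 = 0) = (Bad u).filter (fun k => k % 2 = 1) := by
      ext k; simp
    rw [e] at this
    exact_mod_cast this.symm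
  rw [hsplit]
  refine (add_le_add (hcl 0) (hcl 1)).trans ?_
  have hmem := Finset.mem_Icc.mp hu
  have he1 : Real.exp (2 * α * u / V) ≤ Q₁ ^ (2 * α) :=
    exp_mul_div_le_rpow hV0 hQ₁ (by positivity) hmem.2
  have hu0 : (0 : ℝ) < u := by exact_mod_cast (show 0 < u by omega)
  have hv₀0 : (0 : ℝ) < v₀ := by exact_mod_cast (show 0 < v₀ by omega)
  have hTe1 : Real.exp 4 ≤ Real.log T' := by
    rw [← Real.log_exp (Real.exp 4)]; exact Real.log_le_log (Real.exp_pos _) hTe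
  have he0 : 1 ≤ Real.exp 4 := Real.one_le_exp (by norm_num)
  have hlogT : 0 ≤ Real.log T' := by linarith
  have hllT : 0 ≤ Real.log (Real.log T') := Real.log_nonneg (by linarith)
  have he2 : Real.exp (4 * (V * Real.log T' / u) * Real.log (Real.log T')) ≤
      Real.exp (4 * (V * Real.log T' / v₀) * Real.log (Real.log T')) := by
    rw [Real.exp_le_exp]
    have : V * Real.log T' / u ≤ V * Real.log T' / v₀ := by
      apply div_le_div_of_nonneg_left (by positivity) hv₀0
      exact_mod_cast hmem.1
    nlinarith
  have hT'0 : 0 ≤ T' ^ (2 * α) := Real.rpow_nonneg (by positivity) _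
  set E := Real.exp (4 * (V * Real.log T' / v₀) * Real.log (Real.log T')) with hE
  have hE0 : 0 ≤ E := (Real.exp_pos _).le
  have hone : C₈ * Real.exp (2 * α * u / V) * T' ^ (2 * α) *
      Real.exp (4 * (V * Real.log T' / u) * Real.log (Real.log T')) ≤ C₈ * Q₁ ^ (2 * α) * T' ^ (2 * α) * E := by
    gcongr
  linarith

/-! ### The neighbourhood-enlarged bad set -/

/-- A point `n` is GOOD (all blocks small on `[n, n+1]`). [cite: Lichtman2020, §5.1] -/
def GoodAt (c : ℕ → ℂ) (P₁ Q₁ V α : ℝ) (n : ℕ) : Prop :=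
  ∀ t ∈ Set.Icc (n : ℝ) (n + 1), ∀ v ∈ Icc ⌊V * Real.log P₁⌋₊ ⌊V * Real.log Q₁⌋₊,
    ‖blockPrimePoly c P₁ Q₁ V v t‖ ≤ Real.exp (-(α * v / V))

/-- **Shifts of a unit interval whose `R`-neighbourhood is good are good**: if every `n'` with
`n ≤ n' + R`, `n' ≤ n + R` is good, `R = ⌈2λ⌉ + 1 ≤ n`, then for `t ∈ [n, n+1]` and `|u| ≤ 2λ` every
block satisfies `‖Q_v(1+i(t-u))‖ ≤ e^{-αv/V}`. [folklore] -/
theorem shifts_good {c : ℕ → ℂ} {P₁ Q₁ V α l : ℝ} {n : ℕ} (hn : ⌈2 * l⌉₊ + 1 ≤ n)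
    (hgood : ∀ n' : ℕ, n ≤ n' + (⌈2 * l⌉₊ + 1) → n' ≤ n + (⌈2 * l⌉₊ + 1) → GoodAt c P₁ Q₁ V α n')
    {t : ℝ} (ht : t ∈ Set.Icc (n : ℝ) (n + 1)) {u : ℝ} (hu : u ∈ Set.Icc (-(2 * l)) (2 * l)) :
    ∀ v ∈ Icc ⌊V * Real.log P₁⌋₊ ⌊V * Real.log Q₁⌋₊,
      ‖blockPrimePoly c P₁ Q₁ V v (t - u)‖ ≤ Real.exp (-(α * v / V)) := by
  obtain ⟨ht1, ht2⟩ := ht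
  obtain ⟨hu1, hu2⟩ := hu
  set R := ⌈2 * l⌉₊ + 1 with hR
  have hRge : 2 * l ≤ (⌈2 * l⌉₊ : ℝ) := Nat.le_ceil _
  have hnR : (R : ℝ) ≤ n := by exact_mod_cast hn
  have hRr : (R : ℝ) = ⌈2 * l⌉₊ + 1 := by rw [hR]; push_cast; ring
  have hs0 : 0 ≤ t - u := by linarith
  set n' := ⌊t - u⌋₊ with hn'
  have hn'1 : (n' : ℝ) ≤ t - u := Nat.floor_le hs0
  have hn'2 : t - u < n' + 1 := Nat.lt_floor_add_one _
  have hA : n ≤ n' + R := by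
    have : (n : ℝ) < n' + R := by linarith
    exact_mod_cast this.le
  have hB : n' ≤ n + R := by
    have : (n' : ℝ) ≤ n + R := by linarith
    exact_mod_cast this
  have hg := hgood n' hA hB
  intro v hv
  exact hg (t - u) ⟨hn'1, hn'2.le⟩ v hv

/-- **The enlarged bad set is at most `(2R+1)` times the set of bad points**: if `B''` consists of
points `n` each having a bad `n'` with `n ≤ n' + R`, `n' ≤ n + R`, `n' ∈ B⁺`, then `#B'' ≤ (2R+1) #B⁺`. [folklore] -/
theorem card_enlarged_le (B'' B : Finset ℕ) (R : ℕ)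
    (h : ∀ n ∈ B'', ∃ n' ∈ B, n ≤ n' + R ∧ n' ≤ n + R) :
    #B'' ≤ (2 * R + 1) * #B := by
  classical
  have hsub : B'' ⊆ B.biUnion (fun n' => Icc (n' - R) (n' + R)) := by
    intro n hn
    obtain ⟨n', hn', h1, h2⟩ := h n hn
    rw [Finset.mem_biUnion]
    refine ⟨n', hn', ?_⟩
    rw [Finset.mem_Icc]; omega
  calc #B'' ≤ #(B.biUnion (fun n' => Icc (n' - R) (n' + R))) := card_le_card hsub
    _ ≤ ∑ n' ∈ B, #(Icc (n' - R) (n' + R)) := card_biUnion_le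
    _ ≤ ∑ n' ∈ B, (2 * R + 1) := sum_le_sum fun n' _ => by rw [Nat.card_Icc]; omega
    _ = (2 * R + 1) * #B := by rw [sum_const, smul_eq_mul, mul_comm]

/-! ### Proposition 5.1 at fixed parameters, with the smoothed first decomposition -/

set_option maxHeartbeats 1600000 in
-- the §5.1 assembly at fixed parameters with the repaired `E₁`: one long bookkeeping proof
/-- **Proposition 5.1 at fixed parameters, repaired** (the assembly of §5.1, pp. 14–15, with the
smoothed first decomposition): for `S = {n : n has a prime factor in [P₁,Q₁] and one in [P₂,Q₂]}`
(`1 ≤ P₁ ≤ Q₁ < P₂ ≤ Q₂`), `G(1+it) = ∑_{Y ≤ n ≤ 2Y, n ∈ S} λ(n)χ(n)n^{-1-it}`, `0 ≤ T₀ ≤ T`,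
`T' = ⌊T⌋ + 1`, a CONSTANT first block fineness `V₁ ≥ 2` with threshold exponent `0 < α < 1`, a second
block fineness `V₂ ≥ 1`, smoothing parameters `λ > 0`, `0 < δ₀ ≤ 1/8`, shift radius
`R = ⌈2λ⌉ + 1 ≤ ⌊T₀⌋`:
if `|Q_{v,2}(1+it)| ≤ U` on the unit intervals of `[⌊T₀⌋, T']` (Lemma 4.5), the second-interval cofactor
windows are nonempty, and every set `B` of bad points of `[⌊T₀⌋ - R, T' + R)` (carrying a large value
`|Q_{u,1}| > e^{-αu/V₁}`) satisfies `(2R+1) #B √T' ≤ ⌈Y e^{-v/V₂}⌉` ((5.10)), then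
`∫_{T₀}^{T} |G|²` is at most the repaired good-part bound of `goodPart_le` (at `N_max = ⌊T⌋`) plus
`C₁₂⁺ [V₂ log(Q₂/P₂) #ℐ₂ · 10 C₉⁺ U² log(2T') + (T'+Y)/Y (1/V₂ + 1/P₂)]` (Lemma 12 on the enlarged bad
set with `[P₂,Q₂]` and `E₂` by Halász–Montgomery at the maximisers, as in the tree's `prop51_fixed`).
[cite: Lichtman2020, Proposition 5.1 and §5.1] -/
theorem prop51_fixed33 {C₁₂ C₉ : ℝ} (h12 : Lemma12With C₁₂) (h9 : Lemma9With C₉)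
    {q : ℕ} (χ : DirichletCharacter ℂ q) {Y T T₀ P₁ Q₁ P₂ Q₂ V₁ V₂ α l δ₀ U : ℝ}
    (hY : 2 ≤ Y) (hT₀ : 0 ≤ T₀) (hT₀T : T₀ ≤ T) (hP₁ : 1 ≤ P₁) (hPQ₁ : P₁ ≤ Q₁) (hP₂ : 1 ≤ P₂)
    (hPQ₂ : P₂ ≤ Q₂) (hQP : Q₁ < P₂) (hV₁ : 2 ≤ V₁) (hV₂ : 1 ≤ V₂) (hα : 0 < α) (hα1 : α < 1)
    (hl : 0 < l) (hδ₀ : 0 < δ₀) (hδ₀' : δ₀ ≤ 1 / 8) (hR : ⌈2 * l⌉₊ + 1 ≤ ⌊T₀⌋₊)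
    (hUQ : ∀ v ∈ Icc ⌊V₂ * Real.log P₂⌋₊ ⌊V₂ * Real.log Q₂⌋₊, ∀ n ∈ Finset.Ico ⌊T₀⌋₊ (⌊T⌋₊ + 1),
        ∀ t ∈ Set.Icc (n : ℝ) (n + 1), ‖blockPrimePoly (lamChi χ) P₂ Q₂ V₂ v t‖ ≤ U)
    (hN1 : ∀ v ∈ Icc ⌊V₂ * Real.log P₂⌋₊ ⌊V₂ * Real.log Q₂⌋₊, 1 ≤ ⌊2 * Y * Real.exp (-(v / V₂))⌋₊)
    (hcardB : ∀ B : Finset ℕ,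
        B ⊆ Finset.Ico (⌊T₀⌋₊ - (⌈2 * l⌉₊ + 1)) (⌊T⌋₊ + 1 + (⌈2 * l⌉₊ + 1)) →
        (∀ n ∈ B, ∃ t ∈ Set.Icc (n : ℝ) (n + 1), ∃ u ∈ Icc ⌊V₁ * Real.log P₁⌋₊ ⌊V₁ * Real.log Q₁⌋₊,
            Real.exp (-(α * u / V₁)) < ‖blockPrimePoly (lamChi χ) P₁ Q₁ V₁ u t‖) →
        ∀ v ∈ Icc ⌊V₂ * Real.log P₂⌋₊ ⌊V₂ * Real.log Q₂⌋₊,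
          ((2 * (⌈2 * l⌉₊ + 1) + 1 : ℕ) : ℝ) * #B * Real.sqrt ((⌊T⌋₊ : ℝ) + 1) ≤ ⌈Y * Real.exp (-(v / V₂))⌉₊) :
    ∫ t in T₀..T, ‖∑ n ∈ (Icc ⌈Y⌉₊ ⌊2 * Y⌋₊).filter
        (fun n => HasPrimeFactorIn P₁ Q₁ n ∧ HasPrimeFactorIn P₂ Q₂ n),
        ((ArithmeticFunction.liouville n : ℤ) : ℂ) * χ (n : ZMod q) * (n : ℂ) ^ (-(1 + (t : ℂ) * I))‖ ^ 2 ≤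
      4 * ((5 * (((⌊T⌋₊ : ℕ) : ℝ) + 1) + 72 * Y) * (4 / Y ^ 2) * (5 * Y * (4 / (fejerMass * l * δ₀)) ^ 2 + 8 * δ₀ * Y + 2)
        + (5 * (((⌊T⌋₊ : ℕ) : ℝ) + 1) + 72 * Y) * (32 / (P₁ * Y))
        + (5 * (((⌊T⌋₊ : ℕ) : ℝ) + 1) + 144 * Y) * (96 * (3 / (fejerMass * l)) ^ 2 / Y)
        + (6 * Real.log (1 + 2 * l) / fejerMass) ^ 2 * (Real.exp (α / V₁) * P₁ ^ (-α) * (1 + V₁ / α)) *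
          (15 * (10 * Real.exp (1 / V₁) * (1 + V₁ / (1 - α)) * Q₁ ^ (1 - α) * ((((⌊T⌋₊ : ℕ) : ℝ)) + 2 + 2 * l) / Y
            + 252 * (Real.exp (α / V₁) * P₁ ^ (-α) * (1 + V₁ / α)))))
      + max C₁₂ 0 * ((V₂ * Real.log (Q₂ / P₂)) * (#(Icc ⌊V₂ * Real.log P₂⌋₊ ⌊V₂ * Real.log Q₂⌋₊) *
            (10 * max C₉ 0 * U ^ 2 * Real.log (2 * ((((⌊T⌋₊ : ℕ) : ℝ)) + 1))))
          + ((((⌊T⌋₊ : ℕ) : ℝ) + 1) + Y) / Y * (1 / V₂ + 1 / P₂)) := by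
  classical
  set Nmax := ⌊T⌋₊ with hNmax
  set T' : ℝ := (Nmax : ℝ) + 1 with hT'
  set R := ⌈2 * l⌉₊ + 1 with hRdef
  set 𝒩 := Finset.Ico ⌊T₀⌋₊ (Nmax + 1) with h𝒩
  set 𝒩p := Finset.Ico (⌊T₀⌋₊ - R) (Nmax + 1 + R) with h𝒩p
  set ℐ₁ := Icc ⌊V₁ * Real.log P₁⌋₊ ⌊V₁ * Real.log Q₁⌋₊ with hℐ₁
  set ℐ₂ := Icc ⌊V₂ * Real.log P₂⌋₊ ⌊V₂ * Real.log Q₂⌋₊ with hℐ₂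
  set S : ℕ → Prop := fun n => HasPrimeFactorIn P₁ Q₁ n ∧ HasPrimeFactorIn P₂ Q₂ n with hS
  set f : ℝ → ℝ := fun t => ‖∑ n ∈ (Icc ⌈Y⌉₊ ⌊2 * Y⌋₊).filter S,
    ((ArithmeticFunction.liouville n : ℤ) : ℂ) * χ (n : ZMod q) * (n : ℂ) ^ (-(1 + (t : ℂ) * I))‖ ^ 2 with hf
  have hfc : Continuous f := continuous_norm_sq_G S χ _
  have hf0 : ∀ t, 0 ≤ f t := fun t => by positivity
  have hY1 : 1 ≤ Y := by linarith
  have hY0 : 0 < Y := by linarith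
  have hV₂0 : 0 < V₂ := by linarith
  have hT'1 : 1 ≤ T' := by simp [hT']
  have hT'0 : 0 < T' := by linarith
  have hC₁₂ : 0 ≤ max C₁₂ 0 := le_max_right _ _
  have hC₉ : 0 ≤ max C₉ 0 := le_max_right _ _
  -- good points, the bad points of the enlarged range, the enlarged bad set and its complement
  set good : ℕ → Prop := GoodAt (lamChi χ) P₁ Q₁ V₁ α with hgooddef
  set Bp := 𝒩p.filter (fun n => ¬ good n) with hBp
  set nearBad : ℕ → Prop := fun n => ∃ n' ∈ Bp, n ≤ n' + R ∧ n' ≤ n + R with hnearBad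
  set B := 𝒩.filter nearBad with hB
  set G := 𝒩.filter (fun n => ¬ nearBad n) with hG
  have hGN : ∀ n ∈ G, n ≤ Nmax := fun n hn => by
    have := (Finset.mem_Ico.mp (Finset.mem_filter.mp hn).1).2; omega
  have hBN : ∀ n ∈ B, n ≤ Nmax := fun n hn => by
    have := (Finset.mem_Ico.mp (Finset.mem_filter.mp hn).1).2; omega
  have hsubI : ∀ (F : Finset ℕ), (∀ n ∈ F, n ≤ Nmax) → unitUnion F ⊆ Set.Icc (-T') T' := by
    intro F hF t ht
    obtain ⟨n, hn, h1, h2⟩ := exists_mem_of_mem_unitUnion ht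
    have hn0 : (0 : ℝ) ≤ n := Nat.cast_nonneg n
    have hnN : (n : ℝ) ≤ Nmax := by exact_mod_cast hF n hn
    constructor <;> [skip; skip] <;> simp only [hT'] <;> linarith
  -- Step 1: discretise and split
  have step1 : ∫ t in T₀..T, f t ≤ (∑ n ∈ G, ∫ t in (n : ℝ)..((n + 1 : ℕ) : ℝ), f t)
      + ∑ n ∈ B, ∫ t in (n : ℝ)..((n + 1 : ℕ) : ℝ), f t := by
    refine (intervalIntegral_le_sum_unit hfc hf0 hT₀ hT₀T).trans (le_of_eq ?_)
    have hsplit := Finset.sum_filter_add_sum_filter_not 𝒩 nearBad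
      (fun n => ∫ t in (n : ℝ)..((n + 1 : ℕ) : ℝ), f t)
    rw [hG, hB, ← hsplit]
    exact add_comm _ _
  -- Step 2: the good part, by `goodPart_le` (all shifts of the points of `G` are good)
  have hgoodG : ∀ n ∈ G, ∀ t ∈ Set.Icc (n : ℝ) (n + 1), ∀ u ∈ Set.Icc (-(2 * l)) (2 * l),
      ∀ v ∈ ℐ₁, ‖blockPrimePoly (lamChi χ) P₁ Q₁ V₁ v (t - u)‖ ≤ Real.exp (-(α * v / V₁)) := by
    intro n hn t ht u hu
    rw [hG, Finset.mem_filter] at hn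
    obtain ⟨hn𝒩, hnot⟩ := hn
    have hn𝒩' := Finset.mem_Ico.mp hn𝒩
    have hRn : R ≤ n := hR.trans hn𝒩'.1
    refine shifts_good (l := l) hRn (fun n' h1 h2 => ?_) ht hu
    by_contra hng
    apply hnot
    refine ⟨n', ?_, h1, h2⟩
    rw [hBp, Finset.mem_filter, h𝒩p, Finset.mem_Ico]
    exact ⟨⟨by omega, by omega⟩, hng⟩
  have goodPart := goodPart_le χ hY hP₁ hPQ₁ hQP hV₁ hα hα1 hl hδ₀ hδ₀' Nmax G hGN hgoodG (Q₂ := Q₂)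
  -- Step 3: the bad part
  have hdisj₂ : ∀ p : ℕ, P₂ ≤ p → (p : ℝ) ≤ Q₂ → ¬ (P₁ ≤ p ∧ (p : ℝ) ≤ Q₁) :=
    fun p h1 _ h => by linarith [h.2]
  have badPart : ∑ n ∈ B, ∫ t in (n : ℝ)..((n + 1 : ℕ) : ℝ), f t ≤
      max C₁₂ 0 * ((V₂ * Real.log (Q₂ / P₂)) * (#ℐ₂ * (10 * max C₉ 0 * U ^ 2 * Real.log (2 * T')))
        + (T' + Y) / Y * (1 / V₂ + 1 / P₂)) := by
    rw [← setIntegral_unitUnion hfc B]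
    have hL := ramare_second h12 hY1 hT'1 hP₂ hPQ₂ hV₂ hdisj₂ χ (measurableSet_unitUnion B) (hsubI B hBN)
    refine hL.trans ?_
    -- the count of `B` through the bad points `Bp`
    have hBsub : B ⊆ 𝒩 := Finset.filter_subset _ _
    have hBpsub : Bp ⊆ Finset.Ico (⌊T₀⌋₊ - (⌈2 * l⌉₊ + 1)) (⌊T⌋₊ + 1 + (⌈2 * l⌉₊ + 1)) :=
      Finset.filter_subset _ _
    have hBpbad : ∀ n ∈ Bp, ∃ t ∈ Set.Icc (n : ℝ) (n + 1), ∃ u ∈ ℐ₁,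
        Real.exp (-(α * u / V₁)) < ‖blockPrimePoly (lamChi χ) P₁ Q₁ V₁ u t‖ := by
      intro n hn
      have h := (Finset.mem_filter.mp hn).2
      simp only [hgooddef, GoodAt, not_forall, not_le, exists_prop] at h
      obtain ⟨t, ht, u, hu, hlt⟩ := h
      exact ⟨t, ht, u, hu, hlt⟩
    have hcardB'' : ∀ v ∈ ℐ₂, (#B : ℝ) * Real.sqrt ((Nmax : ℝ) + 1) ≤ ⌈Y * Real.exp (-(v / V₂))⌉₊ := by
      intro v hv
      have h1 : #B ≤ (2 * R + 1) * #Bp :=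
        card_enlarged_le B Bp R fun n hn => (Finset.mem_filter.mp hn).2
      have h2 := hcardB Bp hBpsub hBpbad v hv
      have h1' : (#B : ℝ) ≤ ((2 * (⌈2 * l⌉₊ + 1) + 1 : ℕ) : ℝ) * #Bp := by
        rw [hRdef] at h1; exact_mod_cast h1
      calc (#B : ℝ) * Real.sqrt ((Nmax : ℝ) + 1) ≤ (((2 * (⌈2 * l⌉₊ + 1) + 1 : ℕ) : ℝ) * #Bp) * Real.sqrt ((Nmax : ℝ) + 1) :=
            mul_le_mul_of_nonneg_right h1' (Real.sqrt_nonneg _)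
        _ = ((2 * (⌈2 * l⌉₊ + 1) + 1 : ℕ) : ℝ) * #Bp * Real.sqrt ((⌊T⌋₊ : ℝ) + 1) := by rw [hNmax]
        _ ≤ _ := h2
    have hblocks : ∑ v ∈ ℐ₂, ∫ t in unitUnion B, ‖blockPrimePoly (lamChi χ) P₂ Q₂ V₂ v t *
        blockCofactorPoly (lamChiOn (HasPrimeFactorIn P₁ Q₁) χ) Y P₂ Q₂ V₂ v t‖ ^ 2 ≤
        #ℐ₂ * (10 * max C₉ 0 * U ^ 2 * Real.log (2 * T')) := by
      rw [← nsmul_eq_mul, ← Finset.sum_const]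
      refine Finset.sum_le_sum fun v hv => ?_
      rw [setIntegral_unitUnion (continuous_norm_sq_QR _ _ _ _ _ _ v) B]
      refine E2_block h9 (c := lamChi χ) (norm_lamChiOn_le _ χ) hY0 v Nmax B hBN (hN1 v hv)
        (hcardB'' v hv) ?_
      intro n hn t ht
      exact hUQ v hv n (hBsub hn) t ht
    have hlog : 0 ≤ Real.log (Q₂ / P₂) := Real.log_nonneg (by rw [le_div_iff₀ (by linarith)]; linarith)
    have hS0 : 0 ≤ ∑ v ∈ ℐ₂, ∫ t in unitUnion B, ‖blockPrimePoly (lamChi χ) P₂ Q₂ V₂ v t *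
        blockCofactorPoly (lamChiOn (HasPrimeFactorIn P₁ Q₁) χ) Y P₂ Q₂ V₂ v t‖ ^ 2 :=
      Finset.sum_nonneg fun v _ => setIntegral_nonneg (measurableSet_unitUnion B) fun t _ => by positivity
    have hVlog : 0 ≤ V₂ * Real.log (Q₂ / P₂) := mul_nonneg hV₂0.le hlog
    have hstuff0 : 0 ≤ (V₂ * Real.log (Q₂ / P₂)) * (∑ v ∈ ℐ₂, ∫ t in unitUnion B,
        ‖blockPrimePoly (lamChi χ) P₂ Q₂ V₂ v t *
          blockCofactorPoly (lamChiOn (HasPrimeFactorIn P₁ Q₁) χ) Y P₂ Q₂ V₂ v t‖ ^ 2)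
        + (T' + Y) / Y * (1 / V₂ + 1 / P₂) := by positivity
    calc C₁₂ * ((V₂ * Real.log (Q₂ / P₂)) * (∑ v ∈ ℐ₂, ∫ t in unitUnion B,
          ‖blockPrimePoly (lamChi χ) P₂ Q₂ V₂ v t *
            blockCofactorPoly (lamChiOn (HasPrimeFactorIn P₁ Q₁) χ) Y P₂ Q₂ V₂ v t‖ ^ 2)
          + (T' + Y) / Y * (1 / V₂ + 1 / P₂))
        ≤ max C₁₂ 0 * ((V₂ * Real.log (Q₂ / P₂)) * (∑ v ∈ ℐ₂, ∫ t in unitUnion B,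
          ‖blockPrimePoly (lamChi χ) P₂ Q₂ V₂ v t *
            blockCofactorPoly (lamChiOn (HasPrimeFactorIn P₁ Q₁) χ) Y P₂ Q₂ V₂ v t‖ ^ 2)
          + (T' + Y) / Y * (1 / V₂ + 1 / P₂)) :=
          mul_le_mul_of_nonneg_right (le_max_left _ _) hstuff0
      _ ≤ _ := by
          refine mul_le_mul_of_nonneg_left ?_ hC₁₂
          exact add_le_add (mul_le_mul_of_nonneg_left hblocks hVlog) le_rfl
  -- conclusion
  have := step1.trans (add_le_add goodPart badPart)
  simpa only [hT'] using this

/-! ### Numerical lemmas for the repaired good part -/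

/-- `(5(T_fl + 1) + cY)/Y ≤ (c + 5)(R + 1)` when `0 ≤ T_fl ≤ T`, `Y ≥ 1`, `Q₁ ≥ 1`, `R = Q₁T/Y`, `c ≥ 0`. [folklore] -/
theorem ratio_le {Tfl T Y Q₁ c : ℝ} (hTfl0 : 0 ≤ Tfl) (hTfl : Tfl ≤ T) (hY : 1 ≤ Y) (hQ₁ : 1 ≤ Q₁)
    (hc : 0 ≤ c) : (5 * (Tfl + 1) + c * Y) / Y ≤ (c + 5) * (Q₁ * T / Y + 1) := by
  have hY0 : 0 < Y := by linarith
  have hT0 : 0 ≤ T := hTfl0.trans hTfl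
  rw [div_le_iff₀ hY0]
  have e : (c + 5) * (Q₁ * T / Y + 1) * Y = (c + 5) * (Q₁ * T + Y) := by field_simp
  rw [e]
  have h1 : T ≤ Q₁ * T := le_mul_of_one_le_left hT0 hQ₁
  have h2 : 0 ≤ c * (Q₁ * T) := mul_nonneg hc (by nlinarith)
  nlinarith

/-- **`G₁` (the smoothing error)**: `(5T'+72Y)(4/Y²)(5Yη₁² + 8δ₀Y + 2) ≤ 924 (R+1) s` once
`5η₁² ≤ s`, `8δ₀ ≤ s`, `2/Y ≤ s`. [folklore] -/
theorem G1_numerics {Tfl T Y Q₁ η₁ δ₀ s : ℝ} (hTfl0 : 0 ≤ Tfl) (hTfl : Tfl ≤ T) (hY : 1 ≤ Y) (hQ₁ : 1 ≤ Q₁)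
    (h1 : 5 * η₁ ^ 2 ≤ s) (h2 : 8 * δ₀ ≤ s) (h3 : 2 / Y ≤ s) (hδ₀ : 0 ≤ δ₀) :
    (5 * (Tfl + 1) + 72 * Y) * (4 / Y ^ 2) * (5 * Y * η₁ ^ 2 + 8 * δ₀ * Y + 2) ≤
      924 * (Q₁ * T / Y + 1) * s := by
  have hY0 : 0 < Y := by linarith
  have hr := ratio_le hTfl0 hTfl hY hQ₁ (by norm_num : (0 : ℝ) ≤ 72) (Q₁ := Q₁)
  have e : (5 * (Tfl + 1) + 72 * Y) * (4 / Y ^ 2) * (5 * Y * η₁ ^ 2 + 8 * δ₀ * Y + 2) =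
      ((5 * (Tfl + 1) + 72 * Y) / Y) * (4 * (5 * η₁ ^ 2 + 8 * δ₀ + 2 / Y)) := by
    field_simp
  rw [e]
  have hs : 4 * (5 * η₁ ^ 2 + 8 * δ₀ + 2 / Y) ≤ 12 * s := by linarith
  have h0 : 0 ≤ (5 * (Tfl + 1) + 72 * Y) / Y := by positivity
  have hR0 : 0 ≤ Q₁ * T / Y + 1 := by
    have : 0 ≤ T := hTfl0.trans hTfl
    positivity
  calc (5 * (Tfl + 1) + 72 * Y) / Y * (4 * (5 * η₁ ^ 2 + 8 * δ₀ + 2 / Y))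
      ≤ (77 * (Q₁ * T / Y + 1)) * (12 * s) :=
        mul_le_mul (by linarith) hs (by positivity) (by positivity)
    _ = 924 * (Q₁ * T / Y + 1) * s := by ring

/-- **`G₂` (the `p²`-terms)**: `(5T'+72Y)·32/(P₁Y) ≤ 2464 (R+1) s` once `1/P₁ ≤ s`. [folklore] -/
theorem G2_numerics {Tfl T Y Q₁ P₁ s : ℝ} (hTfl0 : 0 ≤ Tfl) (hTfl : Tfl ≤ T) (hY : 1 ≤ Y) (hQ₁ : 1 ≤ Q₁)
    (hP₁ : 0 < P₁) (h1 : 1 / P₁ ≤ s) :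
    (5 * (Tfl + 1) + 72 * Y) * (32 / (P₁ * Y)) ≤ 2464 * (Q₁ * T / Y + 1) * s := by
  have hY0 : 0 < Y := by linarith
  have hr := ratio_le hTfl0 hTfl hY hQ₁ (by norm_num : (0 : ℝ) ≤ 72) (Q₁ := Q₁)
  have e : (5 * (Tfl + 1) + 72 * Y) * (32 / (P₁ * Y)) = ((5 * (Tfl + 1) + 72 * Y) / Y) * (32 * (1 / P₁)) := by
    field_simp
  rw [e]
  calc (5 * (Tfl + 1) + 72 * Y) / Y * (32 * (1 / P₁)) ≤ (77 * (Q₁ * T / Y + 1)) * (32 * s) :=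
        mul_le_mul (by linarith) (by linarith) (by positivity) (by
          have : 0 ≤ T := hTfl0.trans hTfl
          positivity)
    _ = 2464 * (Q₁ * T / Y + 1) * s := by ring

/-- **`G₃` (the term `D`)**: `(5T'+144Y)·96η'²/Y ≤ 149 (R+1) s` once `96η'² ≤ s`. [folklore] -/
theorem G3_numerics {Tfl T Y Q₁ η' s : ℝ} (hTfl0 : 0 ≤ Tfl) (hTfl : Tfl ≤ T) (hY : 1 ≤ Y) (hQ₁ : 1 ≤ Q₁)
    (h1 : 96 * η' ^ 2 ≤ s) :
    (5 * (Tfl + 1) + 144 * Y) * (96 * η' ^ 2 / Y) ≤ 149 * (Q₁ * T / Y + 1) * s := by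
  have hY0 : 0 < Y := by linarith
  have hr := ratio_le hTfl0 hTfl hY hQ₁ (by norm_num : (0 : ℝ) ≤ 144) (Q₁ := Q₁)
  have e : (5 * (Tfl + 1) + 144 * Y) * (96 * η' ^ 2 / Y) = ((5 * (Tfl + 1) + 144 * Y) / Y) * (96 * η' ^ 2) := by
    field_simp
  rw [e]
  calc (5 * (Tfl + 1) + 144 * Y) / Y * (96 * η' ^ 2) ≤ (149 * (Q₁ * T / Y + 1)) * s :=
        mul_le_mul (by linarith) h1 (by positivity) (by
          have : 0 ≤ T := hTfl0.trans hTfl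
          positivity)
    _ = 149 * (Q₁ * T / Y + 1) * s := by ring

/-- **`G₄` (the smoothed main term)**: with `K = 10 e^{1/2} (1 + 2/(1-1/5))`,
`Φ Λ₀ 15 (K Q₁^{4/5} (T_fl + 2 + 2λ)/Y + 252 Λ₀) ≤ 2 (R+1) s` once
`Φ Λ₀ 15 K Q₁^{4/5} T/Y ≤ R s`, `Φ Λ₀ 15 K Q₁^{4/5} (2 + 2λ)/Y ≤ s` and `Φ Λ₀ 15 · 252 Λ₀ ≤ s`
(`Φ, Λ₀ ≥ 0`). [folklore] -/
theorem G4_numerics {Tfl T Y Q₁ l Φ Λ₀ s R : ℝ} (hTfl : Tfl ≤ T) (hY : 0 < Y)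
    (hΦ : 0 ≤ Φ) (hΛ₀ : 0 ≤ Λ₀) (hQ₁ : 0 ≤ Q₁ ^ (1 - 1 / 5 : ℝ)) (hR : 0 ≤ R)
    (h4a : Φ * Λ₀ * (15 * (10 * Real.exp (1 / 2) * (1 + 2 / (1 - 1 / 5)) * Q₁ ^ (1 - 1 / 5 : ℝ))) * T / Y ≤ R * s)
    (h4b : Φ * Λ₀ * (15 * (10 * Real.exp (1 / 2) * (1 + 2 / (1 - 1 / 5)) * Q₁ ^ (1 - 1 / 5 : ℝ))) * (2 + 2 * l) / Y ≤ s)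
    (h4c : Φ * Λ₀ * (15 * (252 * Λ₀)) ≤ s) :
    Φ * Λ₀ * (15 * (10 * Real.exp (1 / 2) * (1 + 2 / (1 - 1 / 5)) * Q₁ ^ (1 - 1 / 5 : ℝ) * (Tfl + 2 + 2 * l) / Y
      + 252 * Λ₀)) ≤ 2 * (R + 1) * s := by
  set K := 10 * Real.exp (1 / 2) * (1 + 2 / (1 - 1 / 5)) * Q₁ ^ (1 - 1 / 5 : ℝ) with hK
  have hK0 : 0 ≤ K := by positivity
  have hmono : Φ * Λ₀ * (15 * (K * (Tfl + 2 + 2 * l) / Y + 252 * Λ₀)) ≤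
      Φ * Λ₀ * (15 * (K * (T + 2 + 2 * l) / Y + 252 * Λ₀)) := by
    have : K * (Tfl + 2 + 2 * l) / Y ≤ K * (T + 2 + 2 * l) / Y := by
      refine div_le_div_of_nonneg_right ?_ hY.le
      exact mul_le_mul_of_nonneg_left (by linarith) hK0
    have hΦΛ : 0 ≤ Φ * Λ₀ := mul_nonneg hΦ hΛ₀
    nlinarith
  refine hmono.trans ?_
  have e : Φ * Λ₀ * (15 * (K * (T + 2 + 2 * l) / Y + 252 * Λ₀)) =
      Φ * Λ₀ * (15 * K) * T / Y + Φ * Λ₀ * (15 * K) * (2 + 2 * l) / Y + Φ * Λ₀ * (15 * (252 * Λ₀)) := by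
    field_simp
    ring
  rw [e]
  have hs : 0 ≤ s := le_trans (by positivity) h4c
  have hRs : 0 ≤ R * s := mul_nonneg hR hs
  nlinarith

/-- The final real arithmetic: `4(G₁+G₂+G₃+G₄) + bad ≤ (14156 + C_b)(R+1)s`. [folklore] -/
theorem final_numerics33 {G₁ G₂ G₃ G₄ bad Cb R s : ℝ}
    (h1 : G₁ ≤ 924 * (R + 1) * s) (h2 : G₂ ≤ 2464 * (R + 1) * s) (h3 : G₃ ≤ 149 * (R + 1) * s)
    (h4 : G₄ ≤ 2 * (R + 1) * s) (hb : bad ≤ Cb * (R + 1) * s) :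
    4 * (G₁ + G₂ + G₃ + G₄) + bad ≤ (14156 + Cb) * (R + 1) * s := by
  nlinarith

/-! ### The count of bad points at a large `X` (the sharp Lemma 8, `V₁ = 2`, `α = 1/5`) -/

/-- From `k + κ(log 3 + L) + L^{a₁} + L^{a₂} + b log L ≤ L` (`L = log X ≥ 64`):
`e^k (3X)^κ e^{L^{a₁}} e^{L^{a₂}} L^b ≤ X`. [folklore] -/
theorem prod_le_X {X : ℕ} (hL : 64 ≤ Real.log X) {k κ a₁ a₂ b : ℝ}
    (h : k + κ * (Real.log 3 + Real.log X) + Real.log X ^ a₁ + Real.log X ^ a₂ + b * Real.log (Real.log X)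
      ≤ Real.log X) :
    Real.exp k * (3 * (X : ℝ)) ^ κ * Real.exp (Real.log X ^ a₁) * Real.exp (Real.log X ^ a₂) * Real.log X ^ b ≤ X := by
  obtain ⟨hX3, hX0⟩ := X_large hL
  set L := Real.log X with hLdef
  have hL0 : 0 < L := by linarith
  have eX : (X : ℝ) = Real.exp L := (Real.exp_log hX0).symm
  have e4 : (3 * (X : ℝ)) ^ κ = Real.exp (κ * (Real.log 3 + L)) := by
    rw [Real.rpow_def_of_pos (by linarith), Real.log_mul (by norm_num) hX0.ne', ← hLdef]; ring_nf
  have e5 : L ^ b = Real.exp (b * Real.log L) := by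
    rw [Real.rpow_def_of_pos hL0]; ring_nf
  rw [e4, e5, ← Real.exp_add, ← Real.exp_add, ← Real.exp_add, ← Real.exp_add, eX, Real.exp_le_exp]
  linarith

/-- `e⁴ ≤ 55` and `e^{1/2} ≤ 7/4`. [folklore] -/
theorem exp_four_le : Real.exp 4 ≤ 55 ∧ Real.exp (1 / 2 : ℝ) ≤ 7 / 4 := by
  have he := Real.exp_one_lt_d9
  have he0 := Real.exp_pos (1 : ℝ)
  constructor
  · have h4 : Real.exp 4 = (Real.exp 1 ^ 2) ^ 2 := by
      rw [← pow_mul, ← Real.exp_nat_mul]; norm_num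
    have hsq : Real.exp 1 ^ 2 ≤ 7.39 := by nlinarith
    rw [h4]; nlinarith [pow_nonneg he0.le 2]
  · have h3 : Real.exp (1 / 2 : ℝ) ^ 2 = Real.exp 1 := by rw [← Real.exp_nat_mul]; norm_num
    nlinarith [Real.exp_pos (1 / 2 : ℝ)]

set_option maxHeartbeats 1600000 in
-- explicit-constant bookkeeping for the count of bad points (sharp Lemma 8, constant first fineness)
/-- **(5.10) at a large `X`, repaired parameters**: with `V₁ = 2`, `α = 1/5`, `P₁ = L^{33A}` (`L = log X`),
shift radius `R = ⌈2L^{17A}⌉ + 1`, every set `B` of bad points of `[⌊T₀⌋ - R, ⌊T⌋ + 1 + R)` (each carrying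
`|Q_{u,1}(1+it)| > e^{-u/10}`, `u ∈ ℐ₁`) has `(2R+1) #B √(⌊T⌋+1) ≤ Y/Q₂`: for `T⁺ = ⌊T⌋ + R + 1 ≤ X^{1/4}`
trivially, otherwise by `card_bad_le_sharp` (`#ℐ₁ ≤ 3L`, `Q₁^{2/5} ≤ exp(2L^{2/3}/5)`, `T⁺ ≤ 3X`,
`exp(4 (2 log T⁺/v₀) log log T⁺) ≤ T⁺^{16/(65A)}` as `v₀ ≥ 65A log L`, `log log T⁺ ≤ 2 log L`).
[cite: Lichtman2020, (5.10)] -/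
theorem cardB_bound33 {C₈ : ℝ} (hC₈ : 0 ≤ C₈) (h8 : Lemma8SharpWith C₈) {q : ℕ} (χ : DirichletCharacter ℂ q)
    {A : ℝ} {X Hx : ℕ} {Y T Q₂ : ℝ}
    (hL : 512 ≤ Real.log X) (hA : 5 ≤ A)
    (hHx : (Hx : ℝ) ≤ Real.exp (Real.log X ^ (2 / 3 : ℝ)))
    (hPQ₁ : Real.log X ^ (33 * A) ≤ (Hx : ℝ) / Real.log X ^ (4 * A))
    (hT2X : T ≤ 2 * X) (hYlo : (X : ℝ) / Real.log X ^ (6 * A) ≤ Y) (hQ₂1 : 1 ≤ Q₂)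
    (hRX : 2 * Real.log X ^ (17 * A) + 3 ≤ X)
    (hF8 : 40 * Real.log X ^ (17 * A) * (X : ℝ) ^ (3 / 8 : ℝ) * Q₂ * Real.log X ^ (6 * A) ≤ X)
    (hF12 : 20 * Real.log X ^ (17 * A) * (3 * Real.log X) * (2 * C₈) *
        Real.exp (2 / 5 * Real.log X ^ (2 / 3 : ℝ)) * (3 * (X : ℝ)) ^ (9 / 10 + 16 / (65 * A)) * Q₂ *
        Real.log X ^ (6 * A) ≤ X)
    (B : Finset ℕ)
    (hBsub : B ⊆ Finset.Ico (⌊Real.log X ^ (22 * A)⌋₊ - (⌈2 * Real.log X ^ (17 * A)⌉₊ + 1))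
      (⌊T⌋₊ + 1 + (⌈2 * Real.log X ^ (17 * A)⌉₊ + 1)))
    (hbad : ∀ n ∈ B, ∃ t ∈ Set.Icc (n : ℝ) (n + 1),
      ∃ u ∈ Icc ⌊2 * Real.log (Real.log X ^ (33 * A))⌋₊ ⌊2 * Real.log ((Hx : ℝ) / Real.log X ^ (4 * A))⌋₊,
        Real.exp (-(1 / 5 * u / 2)) <
          ‖blockPrimePoly (lamChi χ) (Real.log X ^ (33 * A)) ((Hx : ℝ) / Real.log X ^ (4 * A)) 2 u t‖) :
    ((2 * (⌈2 * Real.log X ^ (17 * A)⌉₊ + 1) + 1 : ℕ) : ℝ) * #B * Real.sqrt ((⌊T⌋₊ : ℝ) + 1) ≤ Y / Q₂ := by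
  have hL64 : 64 ≤ Real.log X := by linarith
  obtain ⟨hX3, hX0⟩ := X_large hL64
  obtain ⟨hlog3, hlog2⟩ := log_three_le_two
  obtain ⟨he4, -⟩ := exp_four_le
  set L := Real.log X with hLdef
  set P₁ := L ^ (33 * A) with hP₁def
  set Q₁ := (Hx : ℝ) / L ^ (4 * A) with hQ₁def
  set l := L ^ (17 * A) with hldef
  set Rn := ⌈2 * l⌉₊ + 1 with hRn
  set Nmax := ⌊T⌋₊ + Rn with hNmax
  set Tp : ℝ := (Nmax : ℝ) + 1 with hTp
  set T' : ℝ := (⌊T⌋₊ : ℝ) + 1 with hT'def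
  have hL1 : 1 ≤ L := by linarith
  have hL0 : 0 < L := by linarith
  have hX1 : (1 : ℝ) ≤ X := by linarith
  have hQ₂0 : 0 < Q₂ := by linarith
  have hA1 : 1 ≤ A := by linarith
  have hl1 : 1 ≤ l := Real.one_le_rpow hL1 (by positivity)
  have hl0 : 0 ≤ l := by linarith
  have hP₁L : L ≤ P₁ := by
    calc L = L ^ (1 : ℝ) := (Real.rpow_one L).symm
      _ ≤ L ^ (33 * A) := Real.rpow_le_rpow_of_exponent_le hL1 (by nlinarith)
  have hP₁0 : 0 < P₁ := by linarith
  have hP₁4 : 4 ≤ P₁ := by linarith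
  have hQ₁1 : 1 ≤ Q₁ := le_trans (by linarith) hPQ₁
  have hQ₁0 : 0 < Q₁ := by linarith
  have h4A : 1 ≤ L ^ (4 * A) := Real.one_le_rpow hL1 (by positivity)
  have hQ₁H : Q₁ ≤ Hx := div_le_self (Nat.cast_nonneg _) h4A
  have hlogQ₁' : Real.log Q₁ ≤ L ^ (2 / 3 : ℝ) := by
    rw [← Real.log_exp (L ^ (2 / 3 : ℝ))]; exact Real.log_le_log hQ₁0 (hQ₁H.trans hHx)
  have hL23 : L ^ (2 / 3 : ℝ) ≤ L := by
    calc L ^ (2 / 3 : ℝ) ≤ L ^ (1 : ℝ) := Real.rpow_le_rpow_of_exponent_le hL1 (by norm_num)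
      _ = L := Real.rpow_one L
  have hlogQ₁ : Real.log Q₁ ≤ L := hlogQ₁'.trans hL23
  -- `Rn`, `Tp`, `T'`
  have hRnr : (Rn : ℝ) = ⌈2 * l⌉₊ + 1 := by rw [hRn]; push_cast; ring
  have hceil : (⌈2 * l⌉₊ : ℝ) < 2 * l + 1 := Nat.ceil_lt_add_one (by positivity)
  have hRnle : (Rn : ℝ) ≤ 2 * l + 2 := by rw [hRnr]; linarith
  have hRn0 : (0 : ℝ) ≤ Rn := Nat.cast_nonneg _
  have hfac : ((2 * (⌈2 * Real.log X ^ (17 * A)⌉₊ + 1) + 1 : ℕ) : ℝ) ≤ 20 * l := by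
    have : ((2 * (⌈2 * Real.log X ^ (17 * A)⌉₊ + 1) + 1 : ℕ) : ℝ) = 2 * Rn + 1 := by
      rw [hRn, hldef]; push_cast; ring
    rw [this]; nlinarith
  have hT'1 : 1 ≤ T' := by simp [hT'def]
  have hT'0 : 0 < T' := by linarith
  have hT'Tp : T' ≤ Tp := by simp only [hT'def, hTp, hNmax]; push_cast; linarith
  have hTp1 : 1 ≤ Tp := hT'1.trans hT'Tp
  have hTp0 : 0 < Tp := by linarith
  have hfloor : (⌊T⌋₊ : ℝ) ≤ 2 * X := by
    rcases le_or_gt 0 T with h | h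
    · exact (Nat.floor_le h).trans hT2X
    · rw [Nat.floor_of_nonpos h.le]; push_cast; positivity
  have hTp3X : Tp ≤ 3 * X := by
    simp only [hTp, hNmax]; push_cast; nlinarith
  have hcardB : (#B : ℝ) ≤ 2 * Tp := by
    have h1 := Finset.card_le_card hBsub
    rw [Nat.card_Ico] at h1
    have h2 : (#B : ℝ) ≤ ((⌊T⌋₊ + 1 + (⌈2 * Real.log X ^ (17 * A)⌉₊ + 1) -
        (⌊Real.log X ^ (22 * A)⌋₊ - (⌈2 * Real.log X ^ (17 * A)⌉₊ + 1)) : ℕ) : ℝ) := by exact_mod_cast h1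
    refine h2.trans ?_
    have h3 : ((⌊T⌋₊ + 1 + (⌈2 * Real.log X ^ (17 * A)⌉₊ + 1) -
        (⌊Real.log X ^ (22 * A)⌋₊ - (⌈2 * Real.log X ^ (17 * A)⌉₊ + 1)) : ℕ) : ℝ) ≤
        ((⌊T⌋₊ + 1 + (⌈2 * Real.log X ^ (17 * A)⌉₊ + 1) : ℕ) : ℝ) := by exact_mod_cast Nat.sub_le _ _
    refine h3.trans ?_
    simp only [hTp, hNmax, hRn, hldef]; push_cast; nlinarith
  -- the target through `X/(L^{6A} Q₂) ≤ Y/Q₂`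
  have h6A : 0 < L ^ (6 * A) := Real.rpow_pos_of_pos hL0 _
  have hgoal : ∀ Z : ℝ, Z * Q₂ * L ^ (6 * A) ≤ X → Z ≤ Y / Q₂ := by
    intro Z hZ
    rw [le_div_iff₀ hQ₂0]
    have h1 : Z * Q₂ ≤ X / L ^ (6 * A) := by rw [le_div_iff₀ h6A]; exact hZ
    exact h1.trans hYlo
  -- two cases
  rcases le_or_gt Tp ((X : ℝ) ^ (1 / 4 : ℝ)) with hsmall | hlarge
  · -- trivial count
    apply hgoal
    have hsq : Real.sqrt T' ≤ (X : ℝ) ^ (1 / 8 : ℝ) := by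
      rw [Real.sqrt_eq_rpow]
      calc T' ^ (1 / 2 : ℝ) ≤ ((X : ℝ) ^ (1 / 4 : ℝ)) ^ (1 / 2 : ℝ) :=
            Real.rpow_le_rpow hT'0.le (hT'Tp.trans hsmall) (by norm_num)
        _ = (X : ℝ) ^ (1 / 8 : ℝ) := by rw [← Real.rpow_mul hX0.le]; norm_num
    have h38 : (#B : ℝ) * Real.sqrt T' ≤ 2 * (X : ℝ) ^ (3 / 8 : ℝ) := by
      calc (#B : ℝ) * Real.sqrt T' ≤ (2 * (X : ℝ) ^ (1 / 4 : ℝ)) * (X : ℝ) ^ (1 / 8 : ℝ) :=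
            mul_le_mul (hcardB.trans (by linarith)) hsq (Real.sqrt_nonneg _) (by positivity)
        _ = 2 * (X : ℝ) ^ (3 / 8 : ℝ) := by rw [mul_assoc, ← Real.rpow_add hX0]; norm_num
    have h0 : 0 ≤ (#B : ℝ) * Real.sqrt T' := by positivity
    calc ((2 * (⌈2 * Real.log X ^ (17 * A)⌉₊ + 1) + 1 : ℕ) : ℝ) * #B * Real.sqrt T' * Q₂ * L ^ (6 * A)
        = ((2 * (⌈2 * Real.log X ^ (17 * A)⌉₊ + 1) + 1 : ℕ) : ℝ) * ((#B : ℝ) * Real.sqrt T') * Q₂ * L ^ (6 * A) := by ring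
      _ ≤ (20 * l) * (2 * (X : ℝ) ^ (3 / 8 : ℝ)) * Q₂ * L ^ (6 * A) := by gcongr
      _ = 40 * Real.log X ^ (17 * A) * (X : ℝ) ^ (3 / 8 : ℝ) * Q₂ * Real.log X ^ (6 * A) := by
          rw [hldef]; ring
      _ ≤ X := hF8
  · -- sharp Lemma 8 count
    apply hgoal
    set v₀ := ⌊2 * Real.log P₁⌋₊ with hv₀def
    have hlogP₁ : Real.log P₁ = 33 * A * Real.log L := by rw [hP₁def, Real.log_rpow hL0]
    have hlogL : 6 ≤ Real.log L := by
      have h1 : Real.log 512 ≤ Real.log L := Real.log_le_log (by norm_num) hL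
      have h2 : (6 : ℝ) ≤ Real.log 512 := by
        rw [Real.le_log_iff_exp_le (by norm_num)]
        have : Real.exp 6 = Real.exp 4 * (Real.exp 1) ^ 2 := by
          rw [← Real.exp_nat_mul, ← Real.exp_add]; norm_num
        rw [this]
        have hsq : Real.exp 1 ^ 2 ≤ 7.39 := by nlinarith [Real.exp_one_lt_d9, Real.exp_pos (1:ℝ)]
        nlinarith [Real.exp_pos (4:ℝ)]
      linarith
    have hVlogP₁ : 2 ≤ 2 * Real.log P₁ := by rw [hlogP₁]; nlinarith
    have hv₀1 : 1 ≤ v₀ := by rw [hv₀def, Nat.one_le_floor_iff]; linarith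
    have hv₀ge : 65 * A * Real.log L ≤ (v₀ : ℝ) := by
      have := Nat.lt_floor_add_one (2 * Real.log P₁)
      rw [hlogP₁] at this
      rw [hv₀def, hlogP₁]
      nlinarith
    have hv₀0 : (0 : ℝ) < v₀ := by exact_mod_cast hv₀1
    -- `X^{1/4} ≥ exp(2L^{2/3})` and `≥ e^{e⁴}`
    have hL13 : (8 : ℝ) ≤ L ^ (1 / 3 : ℝ) := by
      have : (512 : ℝ) ^ (1 / 3 : ℝ) ≤ L ^ (1 / 3 : ℝ) := Real.rpow_le_rpow (by norm_num) hL (by norm_num)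
      have e : (512 : ℝ) ^ (1 / 3 : ℝ) = 8 := by
        rw [show (512 : ℝ) = 8 ^ (3 : ℝ) by norm_num, ← Real.rpow_mul (by norm_num)]; norm_num
      linarith
    have hXquarter : Real.exp (2 * L ^ (2 / 3 : ℝ)) ≤ (X : ℝ) ^ (1 / 4 : ℝ) := by
      rw [Real.rpow_def_of_pos hX0, ← hLdef, Real.exp_le_exp]
      have e2 : L = L ^ (2 / 3 : ℝ) * L ^ (1 / 3 : ℝ) := by
        rw [← Real.rpow_add hL0]; norm_num
      have h0 : 0 ≤ L ^ (2 / 3 : ℝ) := Real.rpow_nonneg hL0.le _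
      nlinarith
    have hTe : Real.exp (Real.exp 4) ≤ Tp := by
      have h1 : Real.exp (Real.exp 4) ≤ (X : ℝ) ^ (1 / 4 : ℝ) := by
        rw [Real.rpow_def_of_pos hX0, ← hLdef, Real.exp_le_exp]; linarith
      linarith
    have hblocks : ∀ u ∈ Icc v₀ ⌊2 * Real.log Q₁⌋₊, 2 ≤ Real.exp (u / 2) ∧ Real.exp (u / 2) ^ 2 ≤ Tp := by
      intro u hu
      rw [Finset.mem_Icc] at hu
      constructor
      · have h1 : Real.log P₁ - 1 / 2 ≤ (u : ℝ) / 2 := by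
          rw [le_div_iff₀ (by norm_num : (0:ℝ) < 2)]
          have h2 : (v₀ : ℝ) ≤ u := by exact_mod_cast hu.1
          have h3 : 2 * Real.log P₁ - 1 ≤ (v₀ : ℝ) := by
            have := Nat.lt_floor_add_one (2 * Real.log P₁); rw [hv₀def]; linarith
          linarith
        have h4 : Real.exp (Real.log P₁ - 1 / 2) ≤ Real.exp (u / 2) := Real.exp_le_exp.mpr h1
        have h5 : Real.exp (Real.log P₁ - 1 / 2) = P₁ / Real.exp (1 / 2) := by
          rw [Real.exp_sub, Real.exp_log hP₁0]
        have h6 : Real.exp (1 / 2 : ℝ) ≤ 2 := by linarith [exp_four_le.2]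
        have h8 : 2 ≤ P₁ / Real.exp (1 / 2) := by
          rw [le_div_iff₀ (Real.exp_pos _)]; nlinarith
        linarith
      · have h1 : Real.exp (u / 2) ^ 2 ≤ Q₁ ^ (2 : ℝ) := by
          have := exp_mul_div_le_rpow (by norm_num : (0:ℝ) < 2) hQ₁1 (by norm_num : (0:ℝ) ≤ 2) hu.2
          rw [← Real.exp_nat_mul]
          refine le_trans (le_of_eq ?_) this
          congr 1; push_cast; ring
        have h2 : Q₁ ^ (2 : ℝ) ≤ Real.exp (2 * L ^ (2 / 3 : ℝ)) := by
          calc Q₁ ^ (2 : ℝ) ≤ (Real.exp (L ^ (2 / 3 : ℝ))) ^ (2 : ℝ) :=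
                Real.rpow_le_rpow hQ₁0.le (hQ₁H.trans hHx) (by norm_num)
            _ = Real.exp (2 * L ^ (2 / 3 : ℝ)) := by rw [← Real.exp_mul]; ring_nf
        linarith
    have hB' : ∀ n ∈ B, n ≤ Nmax ∧ ∃ t ∈ Set.Icc (n : ℝ) (n + 1), ∃ u ∈ Icc v₀ ⌊2 * Real.log Q₁⌋₊,
        Real.exp (-(1 / 5 * u / 2)) < ‖blockPrimePoly (lamChi χ) P₁ Q₁ 2 u t‖ := by
      intro n hn
      refine ⟨?_, hbad n hn⟩
      have := Finset.mem_Ico.mp (hBsub hn)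
      rw [hNmax]; omega
    have key := card_bad_le_sharp hC₈ h8 (norm_lamChi_le χ) (le_refl (2:ℝ)) (by norm_num : (0 : ℝ) < 1 / 5)
      hQ₁1 hv₀1 Nmax hTe hblocks B hB'
    -- bound the factors
    have hI : (#(Icc v₀ ⌊2 * Real.log Q₁⌋₊) : ℝ) ≤ 3 * L := by
      rw [Nat.card_Icc]
      have h1 : ((⌊2 * Real.log Q₁⌋₊ + 1 - v₀ : ℕ) : ℝ) ≤ ⌊2 * Real.log Q₁⌋₊ + 1 := by
        exact_mod_cast Nat.sub_le _ _
      refine h1.trans ?_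
      have h2 : (⌊2 * Real.log Q₁⌋₊ : ℝ) ≤ 2 * Real.log Q₁ :=
        Nat.floor_le (mul_nonneg (by norm_num) (Real.log_nonneg hQ₁1))
      linarith
    have h2α : (2 * (1 / 5) : ℝ) = 2 / 5 := by norm_num
    rw [h2α] at key
    have hQ25 : Q₁ ^ (2 / 5 : ℝ) ≤ Real.exp (2 / 5 * L ^ (2 / 3 : ℝ)) := by
      calc Q₁ ^ (2 / 5 : ℝ) ≤ (Real.exp (L ^ (2 / 3 : ℝ))) ^ (2 / 5 : ℝ) :=
            Real.rpow_le_rpow hQ₁0.le (hQ₁H.trans hHx) (by norm_num)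
        _ = Real.exp (2 / 5 * L ^ (2 / 3 : ℝ)) := by rw [← Real.exp_mul]; ring_nf
    have h3X0 : (0 : ℝ) < 3 * X := by positivity
    have hT25 : Tp ^ (2 / 5 : ℝ) ≤ (3 * (X : ℝ)) ^ (2 / 5 : ℝ) := Real.rpow_le_rpow hTp0.le hTp3X (by norm_num)
    -- the exponential factor
    have hlogTp : 1 ≤ Real.log Tp := by
      rw [← Real.log_exp 1]
      refine Real.log_le_log (Real.exp_pos 1) ?_
      have : Real.exp 1 ≤ Real.exp (Real.exp 4) := Real.exp_le_exp.mpr (by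
        have := Real.add_one_le_exp (4:ℝ); linarith)
      linarith
    have hlogTp0 : 0 ≤ Real.log Tp := by linarith
    have hllTp : Real.log (Real.log Tp) ≤ 2 * Real.log L := by
      have h1 : Real.log Tp ≤ Real.log 3 + L := by
        rw [hLdef, ← Real.log_mul (by norm_num) hX0.ne']
        exact Real.log_le_log hTp0 hTp3X
      have h2 : Real.log 3 + L ≤ L ^ 2 := by nlinarith
      calc Real.log (Real.log Tp) ≤ Real.log (L ^ 2) := Real.log_le_log (by linarith) (h1.trans h2)
        _ = 2 * Real.log L := by rw [Real.log_pow]; push_cast; ring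
    have hllTp0 : 0 ≤ Real.log (Real.log Tp) := Real.log_nonneg hlogTp
    have hE : Real.exp (4 * (2 * Real.log Tp / v₀) * Real.log (Real.log Tp)) ≤ (3 * (X : ℝ)) ^ (16 / (65 * A)) := by
      have hcA0 : 0 < 65 * A := by linarith
      have h1 : 4 * (2 * Real.log Tp / v₀) * Real.log (Real.log Tp) ≤ 16 / (65 * A) * Real.log Tp := by
        have h2 : 8 * Real.log (Real.log Tp) / v₀ ≤ 16 / (65 * A) := by
          rw [div_le_div_iff₀ hv₀0 hcA0]
          calc 8 * Real.log (Real.log Tp) * (65 * A) ≤ 8 * (2 * Real.log L) * (65 * A) := by gcongr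
            _ = 16 * (65 * A * Real.log L) := by ring
            _ ≤ 16 * v₀ := by gcongr
        have e : 4 * (2 * Real.log Tp / v₀) * Real.log (Real.log Tp) =
            (8 * Real.log (Real.log Tp) / v₀) * Real.log Tp := by field_simp; ring
        rw [e]
        exact mul_le_mul_of_nonneg_right h2 hlogTp0
      calc Real.exp (4 * (2 * Real.log Tp / v₀) * Real.log (Real.log Tp))
          ≤ Real.exp (16 / (65 * A) * Real.log Tp) := Real.exp_le_exp.mpr h1
        _ = Tp ^ (16 / (65 * A)) := by rw [Real.rpow_def_of_pos hTp0]; ring_nf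
        _ ≤ (3 * (X : ℝ)) ^ (16 / (65 * A)) := Real.rpow_le_rpow hTp0.le hTp3X (by positivity)
    have hsqrt : Real.sqrt T' ≤ (3 * (X : ℝ)) ^ (1 / 2 : ℝ) := by
      rw [Real.sqrt_eq_rpow]; exact Real.rpow_le_rpow hT'0.le (hT'Tp.trans hTp3X) (by norm_num)
    -- assemble
    have hE0 : 0 ≤ Real.exp (4 * (2 * Real.log Tp / v₀) * Real.log (Real.log Tp)) := (Real.exp_pos _).le
    have hprod : (#B : ℝ) ≤ 3 * L * (2 * C₈ * Real.exp (2 / 5 * L ^ (2 / 3 : ℝ)) * (3 * (X : ℝ)) ^ (2 / 5 : ℝ) *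
        (3 * (X : ℝ)) ^ (16 / (65 * A))) := by
      refine key.trans ?_
      have hfac' : 2 * C₈ * Q₁ ^ (2 / 5 : ℝ) * Tp ^ (2 / 5 : ℝ) *
          Real.exp (4 * (2 * Real.log Tp / v₀) * Real.log (Real.log Tp)) ≤
          2 * C₈ * Real.exp (2 / 5 * L ^ (2 / 3 : ℝ)) * (3 * (X : ℝ)) ^ (2 / 5 : ℝ) * (3 * (X : ℝ)) ^ (16 / (65 * A)) := by
        gcongr
      have hfac0 : 0 ≤ 2 * C₈ * Q₁ ^ (2 / 5 : ℝ) * Tp ^ (2 / 5 : ℝ) *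
          Real.exp (4 * (2 * Real.log Tp / v₀) * Real.log (Real.log Tp)) := by positivity
      calc (#(Icc v₀ ⌊2 * Real.log Q₁⌋₊) : ℝ) * (2 * C₈ * Q₁ ^ (2 / 5 : ℝ) * (((Nmax : ℕ) : ℝ) + 1) ^ (2 / 5 : ℝ) *
            Real.exp (4 * (2 * Real.log (((Nmax : ℕ) : ℝ) + 1) / v₀) * Real.log (Real.log (((Nmax : ℕ) : ℝ) + 1))))
          ≤ (3 * L) * (2 * C₈ * Q₁ ^ (2 / 5 : ℝ) * Tp ^ (2 / 5 : ℝ) *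
            Real.exp (4 * (2 * Real.log Tp / v₀) * Real.log (Real.log Tp))) :=
            mul_le_mul_of_nonneg_right hI hfac0
        _ ≤ (3 * L) * (2 * C₈ * Real.exp (2 / 5 * L ^ (2 / 3 : ℝ)) * (3 * (X : ℝ)) ^ (2 / 5 : ℝ) *
            (3 * (X : ℝ)) ^ (16 / (65 * A))) := mul_le_mul_of_nonneg_left hfac' (by positivity)
    have hcomb : (20 * l) * (3 * L * (2 * C₈ * Real.exp (2 / 5 * L ^ (2 / 3 : ℝ)) * (3 * (X : ℝ)) ^ (2 / 5 : ℝ) *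
        (3 * (X : ℝ)) ^ (16 / (65 * A)))) * (3 * (X : ℝ)) ^ (1 / 2 : ℝ) =
        20 * Real.log X ^ (17 * A) * (3 * Real.log X) * (2 * C₈) * Real.exp (2 / 5 * Real.log X ^ (2 / 3 : ℝ)) *
          (3 * (X : ℝ)) ^ (9 / 10 + 16 / (65 * A)) := by
      have e : (3 * (X : ℝ)) ^ (9 / 10 + 16 / (65 * A)) =
          (3 * (X : ℝ)) ^ (2 / 5 : ℝ) * (3 * (X : ℝ)) ^ (16 / (65 * A)) * (3 * (X : ℝ)) ^ (1 / 2 : ℝ) := by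
        rw [← Real.rpow_add h3X0, ← Real.rpow_add h3X0]; congr 1; ring
      rw [e, hldef]; ring
    have h0B : 0 ≤ (#B : ℝ) := Nat.cast_nonneg _
    set M := 3 * L * (2 * C₈ * Real.exp (2 / 5 * L ^ (2 / 3 : ℝ)) * (3 * (X : ℝ)) ^ (2 / 5 : ℝ) *
        (3 * (X : ℝ)) ^ (16 / (65 * A))) with hM
    have hM0 : 0 ≤ M := by positivity
    have hstep1 : ((2 * (⌈2 * Real.log X ^ (17 * A)⌉₊ + 1) + 1 : ℕ) : ℝ) * #B ≤ (20 * l) * M :=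
      mul_le_mul hfac hprod h0B (by positivity)
    have hstep2 : ((2 * (⌈2 * Real.log X ^ (17 * A)⌉₊ + 1) + 1 : ℕ) : ℝ) * #B * Real.sqrt T' ≤
        (20 * l) * M * (3 * (X : ℝ)) ^ (1 / 2 : ℝ) :=
      mul_le_mul hstep1 hsqrt (Real.sqrt_nonneg _) (by positivity)
    have hstep3 : ((2 * (⌈2 * Real.log X ^ (17 * A)⌉₊ + 1) + 1 : ℕ) : ℝ) * #B * Real.sqrt T' * Q₂ * L ^ (6 * A) ≤
        (20 * l) * M * (3 * (X : ℝ)) ^ (1 / 2 : ℝ) * Q₂ * L ^ (6 * A) :=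
      mul_le_mul_of_nonneg_right (mul_le_mul_of_nonneg_right hstep2 hQ₂0.le) h6A.le
    refine hstep3.trans ?_
    rw [hM, hcomb]
    exact hF12

/-! ### The smoothing constants at a large `X` -/

/-- `5η₁² ≤ L^{-11A}` for `η₁ = 4/(m₀λδ₀)`, `λ = L^{17A}`, `δ₀ = L^{-11A}/16`, once `20480/m₀² ≤ L^A`. [folklore] -/
theorem eta1_bound {L A m₀ : ℝ} (hL : 1 ≤ L) (hm₀ : 0 < m₀) (hE : 20480 / m₀ ^ 2 ≤ L ^ A) :
    5 * (4 / (m₀ * L ^ (17 * A) * (1 / L ^ (11 * A) / 16))) ^ 2 ≤ 1 / L ^ (11 * A) := by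
  have hL0 : 0 < L := by linarith
  have h17 : 0 < L ^ (17 * A) := Real.rpow_pos_of_pos hL0 _
  have h11 : 0 < L ^ (11 * A) := Real.rpow_pos_of_pos hL0 _
  have hA' : 0 < L ^ A := Real.rpow_pos_of_pos hL0 _
  have e1 : 4 / (m₀ * L ^ (17 * A) * (1 / L ^ (11 * A) / 16)) = 64 * L ^ (11 * A) / (m₀ * L ^ (17 * A)) := by
    field_simp; ring
  rw [e1, div_pow, mul_pow, mul_pow]
  have e2 : (L ^ (11 * A)) ^ 2 = L ^ (22 * A) := by rw [← Real.rpow_natCast, ← Real.rpow_mul hL0.le]; ring_nf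
  have e3 : (L ^ (17 * A)) ^ 2 = L ^ (34 * A) := by rw [← Real.rpow_natCast, ← Real.rpow_mul hL0.le]; ring_nf
  rw [e2, e3, ← mul_div_assoc, div_le_div_iff₀ (by positivity) h11, one_mul]
  -- `5·64² L^{22A} L^{11A} ≤ m₀² L^{34A}` iff `20480 L^{33A} ≤ m₀² L^{34A}`
  have e4 : L ^ (22 * A) * L ^ (11 * A) = L ^ (33 * A) := by rw [← Real.rpow_add hL0]; ring_nf
  have e5 : L ^ (34 * A) = L ^ (33 * A) * L ^ A := by rw [← Real.rpow_add hL0]; ring_nf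
  have h33 : 0 < L ^ (33 * A) := Real.rpow_pos_of_pos hL0 _
  have hE' : 20480 ≤ m₀ ^ 2 * L ^ A := by rwa [div_le_iff₀' (by positivity)] at hE
  calc 5 * ((64 : ℝ) ^ 2 * L ^ (22 * A)) * L ^ (11 * A) = 20480 * (L ^ (22 * A) * L ^ (11 * A)) := by ring
    _ = 20480 * L ^ (33 * A) := by rw [e4]
    _ ≤ (m₀ ^ 2 * L ^ A) * L ^ (33 * A) := mul_le_mul_of_nonneg_right hE' h33.le
    _ = m₀ ^ 2 * L ^ (34 * A) := by rw [e5]; ring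

/-- `96η'² ≤ L^{-11A}` for `η' = 3/(m₀λ)`, `λ = L^{17A}`, once `864/m₀² ≤ L^A` (`L ≥ 1`, `A ≥ 0`). [folklore] -/
theorem eta'_bound {L A m₀ : ℝ} (hL : 1 ≤ L) (hA : 0 ≤ A) (hm₀ : 0 < m₀) (hE : 864 / m₀ ^ 2 ≤ L ^ A) :
    96 * (3 / (m₀ * L ^ (17 * A))) ^ 2 ≤ 1 / L ^ (11 * A) := by
  have hL0 : 0 < L := by linarith
  have h17 : 0 < L ^ (17 * A) := Real.rpow_pos_of_pos hL0 _
  have h11 : 0 < L ^ (11 * A) := Real.rpow_pos_of_pos hL0 _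
  rw [div_pow, mul_pow]
  have e3 : (L ^ (17 * A)) ^ 2 = L ^ (34 * A) := by rw [← Real.rpow_natCast, ← Real.rpow_mul hL0.le]; ring_nf
  rw [e3, mul_div_assoc', div_le_div_iff₀ (by positivity) h11, one_mul]
  have e5 : L ^ (34 * A) = L ^ (11 * A) * (L ^ A * L ^ (22 * A)) := by
    rw [← Real.rpow_add hL0, ← Real.rpow_add hL0]; ring_nf
  have h22 : 1 ≤ L ^ (22 * A) := Real.one_le_rpow hL (by positivity)
  have hE' : 864 ≤ m₀ ^ 2 * L ^ A := by rwa [div_le_iff₀' (by positivity)] at hE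
  have hA' : 0 < L ^ A := Real.rpow_pos_of_pos hL0 _
  calc 96 * (3 : ℝ) ^ 2 * L ^ (11 * A) = 864 * L ^ (11 * A) * 1 := by ring
    _ ≤ (m₀ ^ 2 * L ^ A) * L ^ (11 * A) * L ^ (22 * A) := by gcongr
    _ = m₀ ^ 2 * L ^ (34 * A) := by rw [e5]; ring

/-- **The weight of the band-limited average**: `Φ = (6 log(1+2λ)/m₀)² ≤ 51984 A² L/m₀²` for
`λ = L^{17A}`, `A ≥ 1`, `log L ≥ 1`. [folklore] -/
theorem Phi_bound {L A m₀ : ℝ} (hL : 3 ≤ L) (hlogL : 1 ≤ Real.log L) (hA : 1 ≤ A) (hm₀ : 0 < m₀) :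
    (6 * Real.log (1 + 2 * L ^ (17 * A)) / m₀) ^ 2 ≤ 51984 * A ^ 2 * L / m₀ ^ 2 := by
  have hL1 : 1 ≤ L := by linarith
  have hL0 : 0 < L := by linarith
  have hl1 : 1 ≤ L ^ (17 * A) := Real.one_le_rpow hL1 (by positivity)
  have hlog : Real.log (1 + 2 * L ^ (17 * A)) ≤ 19 * A * Real.log L := by
    have h1 : 1 + 2 * L ^ (17 * A) ≤ 3 * L ^ (17 * A) := by linarith
    have h2 : Real.log (1 + 2 * L ^ (17 * A)) ≤ Real.log 3 + 17 * A * Real.log L := by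
      calc Real.log (1 + 2 * L ^ (17 * A)) ≤ Real.log (3 * L ^ (17 * A)) :=
            Real.log_le_log (by positivity) h1
        _ = Real.log 3 + 17 * A * Real.log L := by
            rw [Real.log_mul (by norm_num) (by positivity), Real.log_rpow hL0]
    have h3 := log_three_le_two.1
    nlinarith
  have hlog0 : 0 ≤ Real.log (1 + 2 * L ^ (17 * A)) := Real.log_nonneg (by linarith)
  -- `(log L)² ≤ 4L` (`log L ≤ 2√L`, the tree's `Transcendental.log_sq_le_four_mul`, reproved inline)
  have hsq : Real.log L ^ 2 ≤ 4 * L := by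
    have h := Real.log_le_rpow_div (by linarith : 0 ≤ L) (by norm_num : (0 : ℝ) < 1 / 2)
    have h0 : 0 ≤ Real.log L := Real.log_nonneg hL1
    have h1 : Real.log L ≤ 2 * L ^ (1 / 2 : ℝ) := by
      have : L ^ (1 / 2 : ℝ) / (1 / 2) = 2 * L ^ (1 / 2 : ℝ) := by ring
      linarith [this ▸ h]
    have h2 : (L ^ (1 / 2 : ℝ)) ^ 2 = L := by
      rw [← Real.rpow_natCast, ← Real.rpow_mul (by linarith)]; norm_num
    nlinarith [Real.rpow_nonneg (by linarith : 0 ≤ L) (1 / 2 : ℝ)]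
  rw [div_pow, div_le_div_iff₀ (by positivity) (by positivity)]
  have h4 : (6 * Real.log (1 + 2 * L ^ (17 * A))) ^ 2 ≤ (6 * (19 * A * Real.log L)) ^ 2 :=
    pow_le_pow_left₀ (by positivity) (by linarith) 2
  have h5 : (6 * (19 * A * Real.log L)) ^ 2 = 12996 * A ^ 2 * Real.log L ^ 2 := by ring
  have hm2 : 0 < m₀ ^ 2 := by positivity
  calc (6 * Real.log (1 + 2 * L ^ (17 * A))) ^ 2 * m₀ ^ 2 ≤ (12996 * A ^ 2 * Real.log L ^ 2) * m₀ ^ 2 := by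
        rw [← h5]; exact mul_le_mul_of_nonneg_right h4 hm2.le
    _ ≤ (12996 * A ^ 2 * (4 * L)) * m₀ ^ 2 := by gcongr
    _ = 51984 * A ^ 2 * L * m₀ ^ 2 := by ring

/-- **The block sum constant**: `Λ₀ = e^{1/10} P₁^{-1/5} (1 + 2/(1/5)) ≤ 20 L^{-33A/5}` and
`K = 10 e^{1/2}(1 + 2/(4/5)) ≤ 62` (`P₁ = L^{33A}`). [folklore] -/
theorem Lambda0_K_bound {L A : ℝ} (hL : 0 < L) :
    Real.exp (1 / 5 / 2) * (L ^ (33 * A)) ^ (-(1 / 5 : ℝ)) * (1 + 2 / (1 / 5)) ≤ 20 * L ^ (-(33 * A / 5)) ∧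
      10 * Real.exp (1 / 2) * (1 + 2 / (1 - 1 / 5)) ≤ (62 : ℝ) := by
  obtain ⟨-, he⟩ := exp_four_le
  have he10 : Real.exp (1 / 5 / 2) ≤ 7 / 4 := le_trans (Real.exp_le_exp.2 (by norm_num)) he
  have e1 : (L ^ (33 * A)) ^ (-(1 / 5 : ℝ)) = L ^ (-(33 * A / 5)) := by
    rw [← Real.rpow_mul hL.le]; ring_nf
  rw [e1]
  have h0 : 0 ≤ L ^ (-(33 * A / 5)) := Real.rpow_nonneg hL.le _
  constructor
  · have : (1 + 2 / (1 / 5) : ℝ) = 11 := by norm_num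
    rw [this]; nlinarith
  · have : (1 + 2 / (1 - 1 / 5) : ℝ) = 7 / 2 := by norm_num
    rw [this]; nlinarith

/-- **The three inputs of `G4_numerics` at a large `X`**: with `Φ ≤ Φ_b`, `Λ₀ ≤ 20L^{-33A/5}`, `K ≤ 62`,
`P₁ L ≤ Q₁ ≤ e^{L^{2/3}}`, `Y ≥ X/L^{6A}`, `λ = L^{17A} ≥ 1`, and the two growth conditions
`1512000 Φ_b ≤ L^{11A/5}`, `74400 Φ_b L^{137A/5} e^{L^{2/3}} ≤ X`:
the bounds `h4a`, `h4b`, `h4c`. [folklore] -/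
theorem G4_inputs {L A Φ Φb Λ₀ K Q₁ Y T X l : ℝ} (hL : 1 ≤ L) (hA : 1 ≤ A) (hΦ0 : 0 ≤ Φ) (hΦ : Φ ≤ Φb)
    (hΛ₀0 : 0 ≤ Λ₀) (hΛ₀ : Λ₀ ≤ 20 * L ^ (-(33 * A / 5))) (hK0 : 0 ≤ K) (hK : K ≤ 62)
    (hPQ₁L : L ^ (33 * A) * L ≤ Q₁) (hQ₁H : Q₁ ≤ Real.exp (L ^ (2 / 3 : ℝ))) (hY : X / L ^ (6 * A) ≤ Y)
    (hX : 0 < X) (hT : 0 ≤ T) (hl : l = L ^ (17 * A))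
    (hE46 : 1512000 * Φb ≤ L ^ (11 * A / 5))
    (hE5 : 74400 * Φb * L ^ (137 * A / 5) * Real.exp (L ^ (2 / 3 : ℝ)) ≤ X) :
    Φ * Λ₀ * (15 * (K * Q₁ ^ (1 - 1 / 5 : ℝ))) * T / Y ≤ (Q₁ * T / Y) * (1 / L ^ (11 * A)) ∧
    Φ * Λ₀ * (15 * (K * Q₁ ^ (1 - 1 / 5 : ℝ))) * (2 + 2 * l) / Y ≤ 1 / L ^ (11 * A) ∧
    Φ * Λ₀ * (15 * (252 * Λ₀)) ≤ 1 / L ^ (11 * A) := by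
  have hL0 : 0 < L := by linarith
  have hrp : ∀ r : ℝ, 0 < L ^ r := fun r => Real.rpow_pos_of_pos hL0 r
  have h33 := hrp (33 * A)
  have hQ₁L : L ≤ Q₁ := le_trans (by nlinarith [hrp (33 * A), Real.one_le_rpow hL (by positivity : 0 ≤ 33 * A)]) hPQ₁L
  have hQ₁1 : 1 ≤ Q₁ := hL.trans hQ₁L
  have hQ₁0 : 0 < Q₁ := by linarith
  have h6 := hrp (6 * A)
  have hY0 : 0 < Y := lt_of_lt_of_le (div_pos hX h6) hY
  have hΦb0 : 0 ≤ Φb := hΦ0.trans hΦ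
  have hs : 1 / L ^ (11 * A) = L ^ (-(11 * A)) := by rw [Real.rpow_neg hL0.le, one_div]
  -- `Φ Λ₀ 15 K ≤ 18600 Φb L^{-33A/5}`
  have hmain : Φ * Λ₀ * (15 * K) ≤ 18600 * Φb * L ^ (-(33 * A / 5)) := by
    have h1 : Φ * Λ₀ ≤ Φb * (20 * L ^ (-(33 * A / 5))) := mul_le_mul hΦ hΛ₀ hΛ₀0 hΦb0
    have h2 : 15 * K ≤ 930 := by linarith
    calc Φ * Λ₀ * (15 * K) ≤ (Φb * (20 * L ^ (-(33 * A / 5)))) * 930 :=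
          mul_le_mul h1 h2 (by positivity) (by positivity)
      _ = 18600 * Φb * L ^ (-(33 * A / 5)) := by ring
  have hneg := hrp (-(33 * A / 5))
  refine ⟨?_, ?_, ?_⟩
  · -- h4a: `Q₁^{4/5} T/Y = Q₁^{-1/5} (Q₁T/Y)` and `Q₁^{-1/5} ≤ L^{-33A/5}`
    have e1 : Q₁ ^ (1 - 1 / 5 : ℝ) = Q₁ ^ (-(1 / 5) : ℝ) * Q₁ := by
      rw [show (1 - 1 / 5 : ℝ) = -(1 / 5) + 1 by norm_num, Real.rpow_add hQ₁0, Real.rpow_one]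
    have hQneg : Q₁ ^ (-(1 / 5) : ℝ) ≤ L ^ (-(33 * A / 5)) := by
      have h1 : Q₁ ^ (-(1 / 5) : ℝ) ≤ (L ^ (33 * A)) ^ (-(1 / 5) : ℝ) :=
        Real.rpow_le_rpow_of_nonpos h33 (by nlinarith) (by norm_num)
      rw [← Real.rpow_mul hL0.le] at h1
      refine h1.trans (le_of_eq ?_); ring_nf
    have hR0 : 0 ≤ Q₁ * T / Y := by positivity
    have e2 : Φ * Λ₀ * (15 * (K * Q₁ ^ (1 - 1 / 5 : ℝ))) * T / Y =
        (Φ * Λ₀ * (15 * K)) * Q₁ ^ (-(1 / 5) : ℝ) * (Q₁ * T / Y) := by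
      rw [e1]; field_simp
    rw [e2, hs]
    have hstep : (Φ * Λ₀ * (15 * K)) * Q₁ ^ (-(1 / 5) : ℝ) ≤ (18600 * Φb * L ^ (-(33 * A / 5))) * L ^ (-(33 * A / 5)) :=
      mul_le_mul hmain hQneg (Real.rpow_nonneg hQ₁0.le _) (by positivity)
    have hpow : (18600 * Φb * L ^ (-(33 * A / 5))) * L ^ (-(33 * A / 5)) ≤ L ^ (-(11 * A)) := by
      have e3 : L ^ (-(33 * A / 5)) * L ^ (-(33 * A / 5)) = L ^ (-(11 * A)) * L ^ (-(11 * A / 5)) := by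
        rw [← Real.rpow_add hL0, ← Real.rpow_add hL0]; ring_nf
      have e4 : L ^ (11 * A / 5) * L ^ (-(11 * A / 5)) = 1 := by
        rw [← Real.rpow_add hL0]; simp
      have h5 : 18600 * Φb ≤ L ^ (11 * A / 5) := by linarith
      calc (18600 * Φb * L ^ (-(33 * A / 5))) * L ^ (-(33 * A / 5))
          = (18600 * Φb) * (L ^ (-(11 * A)) * L ^ (-(11 * A / 5))) := by rw [← e3]; ring
        _ ≤ L ^ (11 * A / 5) * (L ^ (-(11 * A)) * L ^ (-(11 * A / 5))) :=
            mul_le_mul_of_nonneg_right h5 (by positivity)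
        _ = L ^ (-(11 * A)) := by rw [show L ^ (11 * A / 5) * (L ^ (-(11 * A)) * L ^ (-(11 * A / 5))) =
              L ^ (-(11 * A)) * (L ^ (11 * A / 5) * L ^ (-(11 * A / 5))) by ring, e4, mul_one]
    calc (Φ * Λ₀ * (15 * K)) * Q₁ ^ (-(1 / 5) : ℝ) * (Q₁ * T / Y)
        ≤ L ^ (-(11 * A)) * (Q₁ * T / Y) := mul_le_mul_of_nonneg_right (hstep.trans hpow) hR0
      _ = Q₁ * T / Y * L ^ (-(11 * A)) := mul_comm _ _
  · -- h4b: `Q₁^{4/5} ≤ Q₁ ≤ e^{L^{2/3}}`, `2 + 2λ ≤ 4λ`, `Y ≥ X/L^{6A}`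
    have hQ45 : Q₁ ^ (1 - 1 / 5 : ℝ) ≤ Q₁ := by
      calc Q₁ ^ (1 - 1 / 5 : ℝ) ≤ Q₁ ^ (1 : ℝ) := Real.rpow_le_rpow_of_exponent_le hQ₁1 (by norm_num)
        _ = Q₁ := Real.rpow_one _
    have hl1 : 1 ≤ l := by rw [hl]; exact Real.one_le_rpow hL (by positivity)
    have hll : 2 + 2 * l ≤ 4 * L ^ (17 * A) := by rw [hl] at hl1 ⊢; linarith
    rw [div_le_iff₀ hY0, hs]
    have hnum : Φ * Λ₀ * (15 * (K * Q₁ ^ (1 - 1 / 5 : ℝ))) * (2 + 2 * l) ≤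
        (18600 * Φb * L ^ (-(33 * A / 5))) * Real.exp (L ^ (2 / 3 : ℝ)) * (4 * L ^ (17 * A)) := by
      have e : Φ * Λ₀ * (15 * (K * Q₁ ^ (1 - 1 / 5 : ℝ))) * (2 + 2 * l) =
          (Φ * Λ₀ * (15 * K)) * Q₁ ^ (1 - 1 / 5 : ℝ) * (2 + 2 * l) := by ring
      rw [e]
      have h1 : (Φ * Λ₀ * (15 * K)) * Q₁ ^ (1 - 1 / 5 : ℝ) ≤ (18600 * Φb * L ^ (-(33 * A / 5))) * Real.exp (L ^ (2 / 3 : ℝ)) :=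
        mul_le_mul hmain (hQ45.trans hQ₁H) (Real.rpow_nonneg hQ₁0.le _) (by positivity)
      exact mul_le_mul h1 hll (by linarith) (by positivity)
    refine hnum.trans ?_
    -- `74400 Φb L^{-33A/5} e^{L^{2/3}} L^{17A} ≤ L^{-11A} Y` from `hE5` and `Y ≥ X/L^{6A}`
    have hXY : X * (L ^ (6 * A))⁻¹ ≤ Y := by rw [← div_eq_mul_inv]; exact hY
    have e5 : L ^ (-(33 * A / 5)) * L ^ (17 * A) = L ^ (-(11 * A)) * L ^ (137 * A / 5) * (L ^ (6 * A))⁻¹ := by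
      rw [← Real.rpow_neg hL0.le, ← Real.rpow_add hL0, ← Real.rpow_add hL0, ← Real.rpow_add hL0]; ring_nf
    have h0 : 0 ≤ (L ^ (6 * A))⁻¹ := by positivity
    calc (18600 * Φb * L ^ (-(33 * A / 5))) * Real.exp (L ^ (2 / 3 : ℝ)) * (4 * L ^ (17 * A))
        = L ^ (-(11 * A)) * ((74400 * Φb * L ^ (137 * A / 5) * Real.exp (L ^ (2 / 3 : ℝ))) * (L ^ (6 * A))⁻¹) := by
          rw [show (18600 * Φb * L ^ (-(33 * A / 5))) * Real.exp (L ^ (2 / 3 : ℝ)) * (4 * L ^ (17 * A)) =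
            74400 * Φb * Real.exp (L ^ (2 / 3 : ℝ)) * (L ^ (-(33 * A / 5)) * L ^ (17 * A)) by ring, e5]
          ring
      _ ≤ L ^ (-(11 * A)) * (X * (L ^ (6 * A))⁻¹) :=
          mul_le_mul_of_nonneg_left (mul_le_mul_of_nonneg_right hE5 h0) (hrp _).le
      _ ≤ L ^ (-(11 * A)) * Y := mul_le_mul_of_nonneg_left hXY (hrp _).le
  · -- h4c
    rw [hs]
    have h1 : Φ * Λ₀ * (15 * (252 * Λ₀)) = 3780 * (Φ * (Λ₀ * Λ₀)) := by ring
    rw [h1]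
    have hΛ2 : Λ₀ * Λ₀ ≤ (20 * L ^ (-(33 * A / 5))) * (20 * L ^ (-(33 * A / 5))) :=
      mul_le_mul hΛ₀ hΛ₀ hΛ₀0 (by positivity)
    have e3 : L ^ (-(33 * A / 5)) * L ^ (-(33 * A / 5)) = L ^ (-(11 * A)) * L ^ (-(11 * A / 5)) := by
      rw [← Real.rpow_add hL0, ← Real.rpow_add hL0]; ring_nf
    have e4 : L ^ (11 * A / 5) * L ^ (-(11 * A / 5)) = 1 := by rw [← Real.rpow_add hL0]; simp
    calc 3780 * (Φ * (Λ₀ * Λ₀)) ≤ 3780 * (Φb * ((20 * L ^ (-(33 * A / 5))) * (20 * L ^ (-(33 * A / 5))))) := by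
          gcongr
      _ = 1512000 * Φb * (L ^ (-(11 * A)) * L ^ (-(11 * A / 5))) := by rw [← e3]; ring
      _ ≤ L ^ (11 * A / 5) * (L ^ (-(11 * A)) * L ^ (-(11 * A / 5))) :=
          mul_le_mul_of_nonneg_right hE46 (by positivity)
      _ = L ^ (-(11 * A)) := by
          rw [show L ^ (11 * A / 5) * (L ^ (-(11 * A)) * L ^ (-(11 * A / 5))) =
            L ^ (-(11 * A)) * (L ^ (11 * A / 5) * L ^ (-(11 * A / 5))) by ring, e4, mul_one]

/-! ### Proposition 5.1 at the printed exponent: the asymptotic wrapper -/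


set_option maxHeartbeats 12800000 in
-- the asymptotic wrapper: many eventual side conditions, one long proof
/-- **Lichtman 2020, Proposition 5.1 AT THE PRINTED EXPONENT `P₁ = (log X)^{33A}`, strong form** — PROVED
from the named fact Lemma 4.5 (`Lichtman2020_primeCharacterSum`, the Vinogradov–Korobov input), every other
input being proved in the tree, by the REPAIRED argument: the first Ramaré decomposition is smoothed and
separated exactly (`MoebiusShiftedPrimesSmoothedRamare.lean`, `…SmoothedMeanValues.lean`) with the
constant block fineness `V₁ = 2` and `α = 1/5` (so `E₁ ≍ P₁^{-2/5} = (log X)^{-13.2A}` up to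
`(A log log X)²`, against the needed `(log X)^{-11A}`), the bad set is enlarged by the shift radius
`R = ⌈2λ⌉ + 1`, `λ = (log X)^{17A}`, and counted with the sharp Lemma 8 (exponent `4`); the second
decomposition, `E₂` and all remaining parameters (`B = 11A`, `V₂ = (log X)^B`, `T₀ = (log X)^{2B}`,
`K = 22A`) are those of the tree's `dirichletMeanValue_strong` (`c ≥ 100`).  Ranges `Y ∈ [X/(log X)^{6A}, 2X]`,
`T ∈ [0, 2X]`. [cite: Lichtman2020, Proposition 5.1] -/
theorem dirichletMeanValue33_strong (h45 : Lichtman2020_primeCharacterSum) :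
    ∀ A : ℝ, 5 < A → ∀ δ : ℝ, 0 < δ → ∀ H : ℕ → ℕ,
    Tendsto (fun X : ℕ => Real.log (H X) / Real.log (Real.log X)) atTop atTop →
    (∀ᶠ X : ℕ in atTop, (H X : ℝ) ≤ Real.exp (Real.log X ^ (2 / 3 : ℝ))) →
    ∃ C : ℝ, ∀ᶠ X : ℕ in atTop, ∀ q : ℕ, 1 ≤ q → (q : ℝ) ≤ Real.log X ^ A →
      ∀ χ : DirichletCharacter ℂ q, ∀ Y : ℝ, (X : ℝ) / Real.log X ^ (6 * A) ≤ Y → Y ≤ 2 * X →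
        ∀ T : ℝ, 0 ≤ T → T ≤ 2 * X →
          ∫ t in (Real.log X ^ (22 * A))..T,
              ‖∑ n ∈ (Icc ⌈Y⌉₊ ⌊2 * Y⌋₊).filter (lichtmanTypical X A δ (H X)),
                  ((ArithmeticFunction.liouville n : ℤ) : ℂ) * χ (n : ZMod q) *
                    (n : ℂ) ^ (-(1 + (t : ℂ) * I))‖ ^ 2
            ≤ C * (((H X : ℝ) / Real.log X ^ (4 * A)) * T / Y + 1) / Real.log X ^ (11 * A) := by
  intro A hA δ hδ H hH hHcap
  obtain ⟨C₁₂, h12'⟩ := lemma12With_of_decomp MatomakiRadziwill2016_lemma12_decomp_holds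
  obtain ⟨C₉, h9'⟩ := lemma9With_of Literature.NumberTheory.LFunctions.MatomakiRadziwill2016_lemma9_holds
  obtain ⟨C₈, hC₈, h8⟩ := exists_lemma8SharpWith
  have hA0 : 0 < A := by linarith
  have hA1 : 1 ≤ A := by linarith
  have hA5 : 5 ≤ A := by linarith
  obtain ⟨C₄₅, h45'⟩ := h45 A (22 * A) (2 / 3 + δ / 4) hA0 (by positivity) (by linarith)
  set D := max C₄₅ 0 with hD
  have hD0 : 0 ≤ D := le_max_right _ _
  set m₀ := fejerMass with hm₀def
  have hm₀ : 0 < m₀ := fejerMass_pos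
  set Cf : ℝ := 14156 + max C₁₂ 0 * (720 * max C₉ 0 * D ^ 2 + 4) with hCf
  refine ⟨Cf, ?_⟩
  set κ : ℝ := 9 / 10 + 16 / (65 * A) with hκdef
  have hκ0 : 0 ≤ κ := by positivity
  have hκ1 : 0 < 1 - κ := by
    have : 16 / (65 * A) ≤ 16 / (65 * 5) := div_le_div_of_nonneg_left (by norm_num) (by norm_num) (by linarith)
    rw [hκdef]; norm_num at this ⊢; linarith
  set Φc : ℝ := 51984 * A ^ 2 / m₀ ^ 2 with hΦc
  have hΦc0 : 0 < Φc := by positivity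
  filter_upwards [tendsto_log_natCast.eventually_ge_atTop (512 : ℝ), hHcap,
    eventually_rpow_log_le_H hH ((33 + 4) * A + 1),
    eventually_small_terms 0 (6 * A) (show (2 / 3 : ℝ) < 1 by norm_num) (show (2 / 3 : ℝ) < 1 by norm_num) one_pos,
    eventually_small_terms (Real.log 2) (6 * A) (show 1 - δ / 2 < 1 by linarith)
      (show 1 - δ / 2 < 1 by linarith) one_pos,
    eventually_small_terms (Real.log 40) (23 * A) (show 1 - δ / 2 < 1 by linarith) (show (2 / 3 : ℝ) < 1 by norm_num)
      (show (0 : ℝ) < 5 / 8 by norm_num),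
    eventually_small_terms (Real.log (120 * max C₈ 1) + κ * Real.log 3) (23 * A + 1) (show (2 / 3 : ℝ) < 1 by norm_num)
      (show 1 - δ / 2 < 1 by linarith) hκ1,
    (tendsto_natCast_atTop_atTop (R := ℝ)).eventually
      (eventually_loglog_le (2 / 3 + δ / 2) (1 / (11 * A)) (by positivity) (by positivity)),
    ((tendsto_rpow_atTop (by positivity : (0 : ℝ) < δ / 4)).comp tendsto_log_natCast).eventually_ge_atTop
      ((2 : ℝ) ^ (2 / 3 + δ / 4)),
    ((tendsto_rpow_atTop hA0).comp tendsto_log_natCast).eventually_ge_atTop (20480 / m₀ ^ 2),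
    ((tendsto_rpow_atTop (show (0 : ℝ) < 11 * A / 5 - 1 by linarith)).comp tendsto_log_natCast).eventually_ge_atTop
      (1512000 * Φc),
    eventually_small_terms (Real.log (74400 * Φc)) (137 * A / 5 + 1) (show (2 / 3 : ℝ) < 1 by norm_num)
      (show (2 / 3 : ℝ) < 1 by norm_num) (show (0:ℝ) < 1 / 2 by norm_num)]
    with X hL512 hHx hHlow hF4 hF5 hF8 hF12 hF13 hF6 hE1 hE46 hE5
  intro q hq hqA χ Y hYlo hYhi T hT0 hT2X
  have hL64 : (64 : ℝ) ≤ Real.log X := by linarith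
  obtain ⟨hX3, hX0⟩ := X_large hL64
  set L := Real.log X with hLdef
  have hL1 : 1 ≤ L := by linarith
  have hL1' : 1 < L := by linarith
  have hL0 : 0 < L := by linarith
  have hrp : ∀ r : ℝ, 0 < L ^ r := fun r => Real.rpow_pos_of_pos hL0 r
  have hrp1 : ∀ r : ℝ, 0 ≤ r → 1 ≤ L ^ r := fun r hr => Real.one_le_rpow hL1 hr
  set Hx := H X with hHxdef
  set V₂ := L ^ (11 * A) with hV₂def
  set T₀ := L ^ (22 * A) with hT₀def
  set P₁ := L ^ (33 * A) with hP₁def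
  set Q₁ := (Hx : ℝ) / L ^ (4 * A) with hQ₁def
  set P₂ := Real.exp (L ^ (2 / 3 + δ / 2)) with hP₂def
  set Q₂ := Real.exp (L ^ (1 - δ / 2)) with hQ₂def
  set l := L ^ (17 * A) with hldef
  set δ₀ : ℝ := 1 / L ^ (11 * A) / 16 with hδ₀def
  -- basic positivity
  have hV₂1 : 1 ≤ V₂ := hrp1 _ (by positivity)
  have hV₂0 : 0 < V₂ := by linarith
  have hT₀0 : 0 ≤ T₀ := (hrp _).le
  have hP₁1 : 1 ≤ P₁ := hrp1 _ (by positivity)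
  have hP₁0 : 0 < P₁ := by linarith
  have h4A1 : 1 ≤ L ^ (4 * A) := hrp1 _ (by positivity)
  have h4A0 : 0 < L ^ (4 * A) := by linarith
  have h6A1 : 1 ≤ L ^ (6 * A) := hrp1 _ (by positivity)
  have h6A0 : 0 < L ^ (6 * A) := by linarith
  have hP₂1 : 1 ≤ P₂ := Real.one_le_exp (Real.rpow_nonneg hL0.le _)
  have hQ₂1 : 1 ≤ Q₂ := Real.one_le_exp (Real.rpow_nonneg hL0.le _)
  have hQ₂0 : 0 < Q₂ := by linarith
  have hl1 : 1 ≤ l := hrp1 _ (by positivity)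
  have hl0 : 0 < l := by linarith
  have hδ₀0 : 0 < δ₀ := by rw [hδ₀def]; have := hrp (11 * A); positivity
  have hδ₀' : δ₀ ≤ 1 / 8 := by
    rw [hδ₀def]
    have h1 : 1 / L ^ (11 * A) ≤ 1 := by
      rw [div_le_one (hrp _)]; exact hrp1 _ (by positivity)
    linarith
  -- `P₁ L ≤ Q₁` from `L^{37A+1} ≤ Hx`
  have hsplit : L ^ ((33 + 4) * A + 1) = P₁ * L ^ (4 * A) * L := by
    rw [hP₁def, ← Real.rpow_add hL0, Real.rpow_add_one hL0.ne']; congr 1; ring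
  have hPQ₁L : P₁ * L ≤ Q₁ := by
    rw [hQ₁def, le_div_iff₀ h4A0]
    calc P₁ * L * L ^ (4 * A) = L ^ ((33 + 4) * A + 1) := by rw [hsplit]; ring
      _ ≤ Hx := hHlow
  have hPQ₁ : P₁ ≤ Q₁ := le_trans (le_mul_of_one_le_right hP₁0.le hL1) hPQ₁L
  have hQ₁1 : 1 ≤ Q₁ := hP₁1.trans hPQ₁
  have hQ₁0 : 0 < Q₁ := by linarith
  have hQ₁H : Q₁ ≤ Hx := div_le_self (Nat.cast_nonneg _) h4A1
  have hQ₁2 : 2 ≤ Q₁ := by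
    have : (1 : ℝ) * 2 ≤ P₁ * L := mul_le_mul hP₁1 (by linarith only [hL64]) (by norm_num) hP₁0.le
    linarith only [this, hPQ₁L]
  -- `Hx ≤ X/L^{6A} ≤ Y`
  have hF4' : Real.exp (L ^ (2 / 3 : ℝ)) * L ^ (6 * A) ≤ X := by
    have h := exp_form_gen hL64 (k := 0) (a := 2 / 3) (b := 6 * A) (by
      have : 0 ≤ Real.log (X : ℝ) ^ (2 / 3 : ℝ) := Real.rpow_nonneg hL0.le _
      linarith)
    simpa using h
  have hHxY : (Hx : ℝ) ≤ X / L ^ (6 * A) := by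
    rw [le_div_iff₀ h6A0]
    calc (Hx : ℝ) * L ^ (6 * A) ≤ Real.exp (L ^ (2 / 3 : ℝ)) * L ^ (6 * A) := by gcongr
      _ ≤ X := hF4'
  have hHxX : (Hx : ℝ) ≤ X := hHxY.trans (div_le_self hX0.le h6A1)
  have hQ₁Y : Q₁ ≤ Y := hQ₁H.trans (hHxY.trans hYlo)
  have hY2 : 2 ≤ Y := hQ₁2.trans hQ₁Y
  have hY1 : 1 ≤ Y := by linarith
  have hY0 : 0 < Y := by linarith
  have hlogQ₁ : Real.log Q₁ ≤ L := by
    calc Real.log Q₁ ≤ Real.log X := Real.log_le_log hQ₁0 (hQ₁H.trans hHxX)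
      _ = L := rfl
  -- `2 Q₂ ≤ X/L^{6A} ≤ Y`
  have hF5' : 2 * Q₂ * L ^ (6 * A) ≤ X := by
    have h := exp_form_gen hL64 (k := Real.log 2) (a := 1 - δ / 2) (b := 6 * A) (by
      have : 0 ≤ Real.log (X : ℝ) ^ (1 - δ / 2) := Real.rpow_nonneg hL0.le _
      linarith)
    rwa [Real.exp_log (by norm_num : (0 : ℝ) < 2)] at h
  have hQ₂Y : 2 * Q₂ ≤ Y := by
    have : 2 * Q₂ ≤ X / L ^ (6 * A) := by rw [le_div_iff₀ h6A0]; exact hF5'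
    exact this.trans hYlo
  have hQ₂X : Q₂ ≤ X := by linarith
  -- `Q₁ < P₂`, `V₂ ≤ P₂`, `exp((2L)^θ) ≤ P₂`
  have hQP : Q₁ < P₂ := by
    refine lt_of_le_of_lt (hQ₁H.trans hHx) ?_
    rw [hP₂def, Real.exp_lt_exp]
    exact Real.rpow_lt_rpow_of_exponent_lt hL1' (by linarith)
  have hVP₂ : V₂ ≤ P₂ := by
    have h1 : 11 * A * Real.log L ≤ L ^ (2 / 3 + δ / 2) := by
      have h2 : Real.log L ≤ 1 / (11 * A) * L ^ (2 / 3 + δ / 2) := hF13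
      have h3 := mul_le_mul_of_nonneg_left h2 (by positivity : (0 : ℝ) ≤ 11 * A)
      refine h3.trans (le_of_eq ?_)
      field_simp
    calc V₂ = Real.exp (11 * A * Real.log L) := by
          rw [hV₂def, Real.rpow_def_of_pos hL0]; ring_nf
      _ ≤ P₂ := Real.exp_le_exp.mpr h1
  have hP₂' : Real.exp ((2 * Real.log X) ^ (2 / 3 + δ / 4)) ≤ P₂ := by
    rw [hP₂def, Real.exp_le_exp, ← hLdef, Real.mul_rpow (by norm_num) hL0.le]
    have e : L ^ (2 / 3 + δ / 2) = L ^ (δ / 4) * L ^ (2 / 3 + δ / 4) := by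
      rw [← Real.rpow_add hL0]; congr 1; ring
    rw [e]
    exact mul_le_mul_of_nonneg_right hF6 (Real.rpow_nonneg hL0.le _)
  -- `2l + 3 ≤ X` and the exponential forms of F8, F12
  have hRX : 2 * L ^ (17 * A) + 3 ≤ X := by
    have h1 : L ^ ((33 + 4) * A + 1) ≤ X := hHlow.trans hHxX
    have h2 : 5 * L ^ (17 * A) ≤ L ^ ((33 + 4) * A + 1) := by
      have e : L ^ ((33 + 4) * A + 1) = L ^ (17 * A) * L ^ (20 * A + 1) := by
        rw [← Real.rpow_add hL0]; congr 1; ring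
      rw [e]
      have : 5 ≤ L ^ (20 * A + 1) := by
        calc (5 : ℝ) ≤ L := by linarith only [hL64]
          _ = L ^ (1 : ℝ) := (Real.rpow_one L).symm
          _ ≤ L ^ (20 * A + 1) := Real.rpow_le_rpow_of_exponent_le hL1 (by linarith only [hA0])
      calc 5 * L ^ (17 * A) = L ^ (17 * A) * 5 := by ring
        _ ≤ L ^ (17 * A) * L ^ (20 * A + 1) := mul_le_mul_of_nonneg_left this (hrp _).le
    linarith only [h1, h2, hrp1 (17 * A) (by positivity)]
  have hF8' : 40 * L ^ (17 * A) * (X : ℝ) ^ (3 / 8 : ℝ) * Q₂ * L ^ (6 * A) ≤ X := by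
    -- `40 l X^{3/8} Q₂ L^{6A} = exp(log 40 + 3L/8 + L^{1-δ/2} + 23A log L) ≤ exp L = X`
    have e1 : (X : ℝ) ^ (3 / 8 : ℝ) = Real.exp (3 / 8 * L) := by
      rw [Real.rpow_def_of_pos hX0, ← hLdef]; ring_nf
    have e2 : L ^ (17 * A) * L ^ (6 * A) = L ^ (23 * A) := by
      rw [← Real.rpow_add hL0]; ring_nf
    have key : Real.log 40 + 3 / 8 * L + L ^ (1 - δ / 2) + 23 * A * Real.log L ≤ L := by
      have : 0 ≤ L ^ (2 / 3 : ℝ) := (hrp _).le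
      linarith
    have eX : (X : ℝ) = Real.exp L := (Real.exp_log hX0).symm
    have e5 : L ^ (23 * A) = Real.exp (23 * A * Real.log L) := by rw [Real.rpow_def_of_pos hL0]; ring_nf
    calc 40 * L ^ (17 * A) * (X : ℝ) ^ (3 / 8 : ℝ) * Q₂ * L ^ (6 * A)
        = 40 * (X : ℝ) ^ (3 / 8 : ℝ) * Q₂ * (L ^ (17 * A) * L ^ (6 * A)) := by ring
      _ = Real.exp (Real.log 40 + 3 / 8 * L + L ^ (1 - δ / 2) + 23 * A * Real.log L) := by
          rw [e2, e1, hQ₂def, e5, Real.exp_add, Real.exp_add, Real.exp_add, Real.exp_log (by norm_num : (0:ℝ) < 40)]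
      _ ≤ X := by rw [eX, Real.exp_le_exp]; exact key
  have hF12' : 20 * L ^ (17 * A) * (3 * L) * (2 * C₈) *
      Real.exp (2 / 5 * L ^ (2 / 3 : ℝ)) * (3 * (X : ℝ)) ^ (9 / 10 + 16 / (65 * A)) * Q₂ *
      L ^ (6 * A) ≤ X := by
    have hC₈1 : C₈ ≤ max C₈ 1 := le_max_left _ _
    have hC₈' : 0 < max C₈ 1 := lt_of_lt_of_le one_pos (le_max_right _ _)
    -- compare with `prod_le_X` at `k = log(120 max C₈ 1)`, `κ`, `a₁ = 2/3`, `a₂ = 1-δ/2`, `b = 23A+1`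
    have h := prod_le_X hL64 (k := Real.log (120 * max C₈ 1)) (κ := κ) (a₁ := 2 / 3) (a₂ := 1 - δ / 2)
      (b := 23 * A + 1) (by
        show Real.log (120 * max C₈ 1) + κ * (Real.log 3 + L) + L ^ (2 / 3 : ℝ) + L ^ (1 - δ / 2) +
          (23 * A + 1) * Real.log L ≤ L
        linarith)
    rw [Real.exp_log (by positivity), ← hLdef] at h
    refine le_trans ?_ h
    have e2 : L ^ (17 * A) * (3 * L) * L ^ (6 * A) = 3 * L ^ (23 * A + 1) := by
      have h1 : L ^ (17 * A) * L ^ (6 * A) * L = L ^ (23 * A + 1) := by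
        rw [← Real.rpow_add hL0, ← Real.rpow_add_one hL0.ne']; ring_nf
      calc L ^ (17 * A) * (3 * L) * L ^ (6 * A) = 3 * (L ^ (17 * A) * L ^ (6 * A) * L) := by ring
        _ = 3 * L ^ (23 * A + 1) := by rw [h1]
    have h25 : Real.exp (2 / 5 * L ^ (2 / 3 : ℝ)) ≤ Real.exp (L ^ (2 / 3 : ℝ)) :=
      Real.exp_le_exp.2 (by nlinarith [hrp (2 / 3)])
    have h3X : 0 ≤ (3 * (X : ℝ)) ^ κ := Real.rpow_nonneg (by positivity) _
    calc 20 * L ^ (17 * A) * (3 * L) * (2 * C₈) *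
          Real.exp (2 / 5 * L ^ (2 / 3 : ℝ)) * (3 * (X : ℝ)) ^ (9 / 10 + 16 / (65 * A)) * Q₂ * L ^ (6 * A)
        = (40 * C₈) * (3 * (X : ℝ)) ^ κ * Real.exp (2 / 5 * L ^ (2 / 3 : ℝ)) * Q₂ *
          (L ^ (17 * A) * (3 * L) * L ^ (6 * A)) := by rw [hκdef]; ring
      _ = (120 * C₈) * (3 * (X : ℝ)) ^ κ * Real.exp (2 / 5 * L ^ (2 / 3 : ℝ)) * Real.exp (L ^ (1 - δ / 2)) *
          L ^ (23 * A + 1) := by rw [e2, hQ₂def]; ring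
      _ ≤ (120 * max C₈ 1) * (3 * (X : ℝ)) ^ κ * Real.exp (L ^ (2 / 3 : ℝ)) * Real.exp (L ^ (1 - δ / 2)) *
          L ^ (23 * A + 1) := by gcongr
  -- degenerate case `P₂ > Q₂`: `S = ∅`
  have hRHS0 : 0 ≤ Cf * (((Hx : ℝ) / L ^ (4 * A)) * T / Y + 1) / L ^ (11 * A) := by
    have : 0 ≤ max C₁₂ 0 := le_max_right _ _
    have : 0 ≤ max C₉ 0 := le_max_right _ _
    positivity
  rcases lt_or_ge Q₂ P₂ with hPQ₂ | hPQ₂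
  · have hempty : (Icc ⌈Y⌉₊ ⌊2 * Y⌋₊).filter (lichtmanTypical X A δ Hx) = ∅ := by
      rw [Finset.filter_eq_empty_iff]
      intro n _ hS
      obtain ⟨-, p, -, h1, h2⟩ := hS
      exact absurd (h1.trans h2) (not_le.mpr hPQ₂)
    rw [hempty]
    simp only [Finset.sum_empty, norm_zero]
    rw [zero_pow two_ne_zero, intervalIntegral.integral_zero]
    exact hRHS0
  -- degenerate case `T < T₀`
  rcases lt_or_ge T T₀ with hTlt | hTge
  · refine le_trans ?_ hRHS0
    rw [intervalIntegral.integral_symm]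
    refine neg_nonpos.mpr (intervalIntegral.integral_nonneg hTlt.le fun t _ => by positivity)
  -- the hypotheses of `prop51_fixed33`
  have hX65 : (65 : ℝ) ≤ X := by
    have h1 : Real.exp 64 ≤ X := by rw [← Real.exp_log hX0]; exact Real.exp_le_exp.mpr hL64
    linarith only [h1, Real.add_one_le_exp (64 : ℝ)]
  have hX'2 : (2 : ℝ) ≤ (X : ℝ) ^ 2 := by nlinarith only [hX65]
  have h45X := h45' ((X : ℝ) ^ 2) hX'2
  have hUQ : ∀ v ∈ Icc ⌊V₂ * Real.log P₂⌋₊ ⌊V₂ * Real.log Q₂⌋₊, ∀ n ∈ Finset.Ico ⌊T₀⌋₊ (⌊T⌋₊ + 1),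
      ∀ t ∈ Set.Icc (n : ℝ) (n + 1), ‖blockPrimePoly (lamChi χ) P₂ Q₂ V₂ v t‖ ≤ 3 * D * L ^ (1 - 22 * A) :=
    fun v _ n hn t ht => UQ_bound h45X hL64 hA0 hq hqA χ hP₂' hQ₂X hT2X v hn ht
  have hN1 : ∀ v ∈ Icc ⌊V₂ * Real.log P₂⌋₊ ⌊V₂ * Real.log Q₂⌋₊, 1 ≤ ⌊2 * Y * Real.exp (-(v / V₂))⌋₊ := by
    intro v hv
    rw [Nat.one_le_floor_iff]
    have h1 : Y / Q₂ ≤ Y * Real.exp (-(v / V₂)) :=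
      div_le_mul_exp_neg hY0.le hV₂0 hQ₂1 (Finset.mem_Icc.mp hv).2
    have h2 : 2 ≤ Y / Q₂ := by rw [le_div_iff₀ hQ₂0]; linarith
    linarith
  have hR : ⌈2 * l⌉₊ + 1 ≤ ⌊T₀⌋₊ := by
    have h1 : (⌈2 * l⌉₊ : ℝ) < 2 * l + 1 := Nat.ceil_lt_add_one (by positivity)
    have h2 : 2 * l + 3 ≤ T₀ := by
      have e : T₀ = L ^ (5 * A) * l := by rw [hT₀def, hldef, ← Real.rpow_add hL0]; ring_nf
      have h5 : 5 ≤ L ^ (5 * A) := by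
        calc (5 : ℝ) ≤ L := by linarith
          _ = L ^ (1 : ℝ) := (Real.rpow_one L).symm
          _ ≤ L ^ (5 * A) := Real.rpow_le_rpow_of_exponent_le hL1 (by linarith)
      have h6 : 5 * l ≤ L ^ (5 * A) * l := mul_le_mul_of_nonneg_right h5 hl0.le
      rw [e]; linarith only [h6, hl1]
    have h3 : ((⌈2 * l⌉₊ + 1 : ℕ) : ℝ) ≤ T₀ := by push_cast; linarith only [h1, h2]
    exact Nat.le_floor h3
  have hcardB : ∀ B : Finset ℕ,
      B ⊆ Finset.Ico (⌊T₀⌋₊ - (⌈2 * l⌉₊ + 1)) (⌊T⌋₊ + 1 + (⌈2 * l⌉₊ + 1)) →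
      (∀ n ∈ B, ∃ t ∈ Set.Icc (n : ℝ) (n + 1), ∃ u ∈ Icc ⌊2 * Real.log P₁⌋₊ ⌊2 * Real.log Q₁⌋₊,
          Real.exp (-(1 / 5 * u / 2)) < ‖blockPrimePoly (lamChi χ) P₁ Q₁ 2 u t‖) →
      ∀ v ∈ Icc ⌊V₂ * Real.log P₂⌋₊ ⌊V₂ * Real.log Q₂⌋₊,
        ((2 * (⌈2 * l⌉₊ + 1) + 1 : ℕ) : ℝ) * #B * Real.sqrt ((⌊T⌋₊ : ℝ) + 1) ≤ ⌈Y * Real.exp (-(v / V₂))⌉₊ := by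
    intro B hBsub hbad v hv
    have h1 := cardB_bound33 hC₈ h8 χ hL512 hA5 hHx hPQ₁ hT2X hYlo hQ₂1 hRX hF8' hF12' B hBsub hbad
    exact h1.trans (div_le_cofactorWindow hY0.le hV₂0 hQ₂1 (Finset.mem_Icc.mp hv).2)
  -- the main inequality at fixed `X`
  have key := prop51_fixed33 h12' h9' χ hY2 hT₀0 hTge hP₁1 hPQ₁ hP₂1 hPQ₂ hQP (le_refl (2 : ℝ)) hV₂1
    (by norm_num : (0 : ℝ) < 1 / 5) (by norm_num : (1 / 5 : ℝ) < 1) hl0 hδ₀0 hδ₀' hR hUQ hN1 hcardB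
  have hfilter : (Icc ⌈Y⌉₊ ⌊2 * Y⌋₊).filter (lichtmanTypical X A δ Hx) =
      (Icc ⌈Y⌉₊ ⌊2 * Y⌋₊).filter (fun n => HasPrimeFactorIn P₁ Q₁ n ∧ HasPrimeFactorIn P₂ Q₂ n) := by
    ext n
    simp only [Finset.mem_filter]
    exact Iff.rfl
  rw [hfilter]
  refine key.trans ?_
  -- numerics
  set s : ℝ := 1 / L ^ (11 * A) with hsdef
  have hs0 : 0 < s := by positivity
  have hsrpow : 1 / V₂ = s := by rw [hV₂def]
  set Rr : ℝ := Q₁ * T / Y with hRr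
  have hRr0 : 0 ≤ Rr := by positivity
  set Tfl : ℝ := ((⌊T⌋₊ : ℕ) : ℝ) with hTfl
  have hTfl0 : 0 ≤ Tfl := Nat.cast_nonneg _
  have hTflT : Tfl ≤ T := Nat.floor_le hT0
  -- G1
  have hE1' : 20480 / m₀ ^ 2 ≤ L ^ A := hE1
  have hE3' : 864 / m₀ ^ 2 ≤ L ^ A := le_trans (div_le_div_of_nonneg_right (by norm_num) (by positivity)) hE1
  have hη₁ := eta1_bound hL1 hm₀ hE1' (A := A)
  have h2Y : 2 / Y ≤ s := by
    rw [hsdef, div_le_div_iff₀ hY0 (hrp _), one_mul]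
    -- `2 L^{11A} ≤ Y` from `2 L^{17A} ≤ X` and `Y ≥ X/L^{6A}`
    have h1 : 2 * L ^ (11 * A) * L ^ (6 * A) ≤ X := by
      have e : L ^ (11 * A) * L ^ (6 * A) = L ^ (17 * A) := by rw [← Real.rpow_add hL0]; ring_nf
      rw [mul_assoc, e]
      have h' : 2 * L ^ (17 * A) + 3 ≤ X := hRX
      linarith
    have h2 : 2 * L ^ (11 * A) ≤ X / L ^ (6 * A) := by rw [le_div_iff₀ h6A0]; exact h1
    linarith [h2.trans hYlo]
  have h8δ₀ : 8 * δ₀ ≤ s := by rw [hδ₀def, hsdef]; have := hrp (11 * A); rw [show 8 * (1 / L ^ (11 * A) / 16) = (1 / L ^ (11 * A)) / 2 by ring]; linarith [show 0 ≤ 1 / L ^ (11 * A) by positivity]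
  have hG1 := G1_numerics hTfl0 hTflT hY1 hQ₁1 hη₁ h8δ₀ h2Y hδ₀0.le (η₁ := 4 / (m₀ * L ^ (17 * A) * (1 / L ^ (11 * A) / 16)))
  -- G2
  have hP₁s : 1 / P₁ ≤ s := by
    rw [hsdef, hP₁def]
    exact one_div_le_one_div_of_le (hrp _) (Real.rpow_le_rpow_of_exponent_le hL1 (by nlinarith))
  have hG2 := G2_numerics hTfl0 hTflT hY1 hQ₁1 hP₁0 hP₁s
  -- G3
  have hη' := eta'_bound hL1 hA0.le hm₀ hE3'
  have hG3 := G3_numerics hTfl0 hTflT hY1 hQ₁1 hη' (T := T)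
  -- G4
  have hlogL : 1 ≤ Real.log L := by
    rw [← Real.log_exp 1]
    refine Real.log_le_log (Real.exp_pos 1) ?_
    have := Real.exp_one_lt_d9; linarith
  have hΦ := Phi_bound (by linarith : (3 : ℝ) ≤ L) hlogL hA1 hm₀
  obtain ⟨hΛ₀, hK⟩ := Lambda0_K_bound hL0 (A := A)
  have hΦbeq : 51984 * A ^ 2 * L / m₀ ^ 2 = Φc * L := by rw [hΦc]; ring
  rw [hΦbeq] at hΦ
  have hE46' : 1512000 * (Φc * L) ≤ L ^ (11 * A / 5) := by
    have e : L ^ (11 * A / 5) = L ^ (11 * A / 5 - 1) * L := by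
      rw [← Real.rpow_add_one hL0.ne']; ring_nf
    have hE46'' : 1512000 * Φc ≤ L ^ (11 * A / 5 - 1) := hE46
    rw [e]
    calc 1512000 * (Φc * L) = (1512000 * Φc) * L := by ring
      _ ≤ L ^ (11 * A / 5 - 1) * L := mul_le_mul_of_nonneg_right hE46'' hL0.le
  have hE5' : 74400 * (Φc * L) * L ^ (137 * A / 5) * Real.exp (L ^ (2 / 3 : ℝ)) ≤ X := by
    have h := exp_form_gen hL64 (k := Real.log (74400 * Φc)) (a := 2 / 3) (b := 137 * A / 5 + 1) (by
      show Real.log (74400 * Φc) + L ^ (2 / 3 : ℝ) + (137 * A / 5 + 1) * Real.log L ≤ L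
      have : 0 ≤ L ^ (2 / 3 : ℝ) := (hrp _).le
      linarith)
    rw [Real.exp_log (by positivity), ← hLdef, Real.rpow_add_one hL0.ne'] at h
    linarith [h, show 74400 * (Φc * L) * L ^ (137 * A / 5) * Real.exp (L ^ (2 / 3 : ℝ)) =
      74400 * Φc * Real.exp (L ^ (2 / 3 : ℝ)) * (L ^ (137 * A / 5) * L) by ring]
  obtain ⟨h4a, h4b, h4c⟩ := G4_inputs hL1 hA1 (sq_nonneg _) hΦ (by positivity) hΛ₀ (by positivity) hK
    hPQ₁L (hQ₁H.trans hHx) hYlo hX0 hT0 hldef hE46' hE5' (T := T)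
  have hG4 := G4_numerics hTflT hY0 (sq_nonneg _) (by positivity) (Real.rpow_nonneg hQ₁0.le _) hRr0 h4a h4b h4c
    (l := l) (Tfl := Tfl)
  -- the bad part (as in the tree)
  have hT'1 : (1 : ℝ) ≤ Tfl + 1 := by linarith only [hTfl0]
  have hT'0 : (0 : ℝ) < Tfl + 1 := by linarith only [hTfl0]
  have hTY : ((Tfl + 1) + Y) / Y ≤ Rr + 2 := by
    rw [div_le_iff₀ hY0]
    have h1' : T ≤ Rr * Y := by
      rw [hRr, div_mul_cancel₀ _ (by linarith only [hY0] : Y ≠ 0)]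
      exact le_mul_of_one_le_left hT0 hQ₁1
    nlinarith only [h1', hTflT, hY1]
  have hVP₂' : V₂ ≤ P₂ := hVP₂
  have h4 : ((Tfl + 1) + Y) / Y * (1 / V₂ + 1 / P₂) ≤ 4 * (Rr + 1) * (1 / V₂) :=
    err_numerics hV₂0 hVP₂' hRr0 hY0 hT'0.le hTY
  have hlog2T' : Real.log (2 * (Tfl + 1)) ≤ 2 * L := by
    have h1' : 2 * (Tfl + 1) ≤ (X : ℝ) ^ 2 := by nlinarith only [hTflT, hT2X, hX65, hTfl0]
    calc Real.log (2 * (Tfl + 1)) ≤ Real.log ((X : ℝ) ^ 2) := Real.log_le_log (by linarith only [hTfl0]) h1'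
      _ = 2 * L := by rw [Real.log_pow]; push_cast; ring
  have h3 : (V₂ * Real.log (Q₂ / P₂)) * (#(Icc ⌊V₂ * Real.log P₂⌋₊ ⌊V₂ * Real.log Q₂⌋₊) *
      (10 * max C₉ 0 * (3 * D * L ^ (1 - 22 * A)) ^ 2 * Real.log (2 * (Tfl + 1)))) ≤
      720 * max C₉ 0 * D ^ 2 * (1 / V₂) := by
    rw [hsrpow, hsdef, one_div, ← Real.rpow_neg hL0.le]
    exact E2_factor_numerics hL1 hA hδ (le_max_right C₉ 0) rfl rfl rfl hPQ₂ hT'1 hlog2T'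
  have hbad : max C₁₂ 0 * ((V₂ * Real.log (Q₂ / P₂)) * (#(Icc ⌊V₂ * Real.log P₂⌋₊ ⌊V₂ * Real.log Q₂⌋₊) *
        (10 * max C₉ 0 * (3 * D * L ^ (1 - 22 * A)) ^ 2 * Real.log (2 * (Tfl + 1))))
      + ((Tfl + 1) + Y) / Y * (1 / V₂ + 1 / P₂)) ≤ (max C₁₂ 0 * (720 * max C₉ 0 * D ^ 2 + 4)) * (Rr + 1) * s := by
    rw [hsrpow] at h3 h4
    have hC : 0 ≤ max C₁₂ 0 := le_max_right _ _
    have hin : (V₂ * Real.log (Q₂ / P₂)) * (#(Icc ⌊V₂ * Real.log P₂⌋₊ ⌊V₂ * Real.log Q₂⌋₊) *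
        (10 * max C₉ 0 * (3 * D * L ^ (1 - 22 * A)) ^ 2 * Real.log (2 * (Tfl + 1))))
      + ((Tfl + 1) + Y) / Y * (1 / V₂ + 1 / P₂) ≤ (720 * max C₉ 0 * D ^ 2 + 4) * (Rr + 1) * s := by
      have : 720 * max C₉ 0 * D ^ 2 * s ≤ 720 * max C₉ 0 * D ^ 2 * ((Rr + 1) * s) := by
        have h0 : 0 ≤ 720 * max C₉ 0 * D ^ 2 := by have := le_max_right C₉ 0; positivity
        refine mul_le_mul_of_nonneg_left ?_ h0
        nlinarith only [hRr0, hs0.le]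
      linarith only [h3, h4, this]
    calc _ ≤ max C₁₂ 0 * ((720 * max C₉ 0 * D ^ 2 + 4) * (Rr + 1) * s) := mul_le_mul_of_nonneg_left hin hC
      _ = _ := by ring
  -- conclusion
  have hfin := final_numerics33 hG1 hG2 hG3 hG4 hbad
  have hRHS : (14156 + max C₁₂ 0 * (720 * max C₉ 0 * D ^ 2 + 4)) * (Rr + 1) * s =
      Cf * (Q₁ * T / Y + 1) / L ^ (11 * A) := by
    rw [hCf, hRr, hsdef]; ring
  rw [← hRHS]
  refine le_trans (le_of_eq ?_) hfin
  rfl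

end Literature.NumberTheory.Sieve.Lichtman2020.Smoothed
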